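import Mathlib
import Literature.MathematicalPhysics.QuantumFieldTheory.MagnenRivasseauSeneor1993.MRS93AxialYMAction
import HarnessLib

/-!
# Magnen–Rivasseau–Sénéor (CMP 155, 1993): the BACKGROUND-GAUGE COVARIANT DERIVATIVE `∇_B(A_s, B_l, γ, 2)` of
# (II.38), the gauge-fixing factor `e^{−(ζ/2)(∇_B(A_s,B_l,γ,2))²}` and the normalisation `K_{ρ₂}(A_s, B_l)` of (II.37)
# — the analogue of the Faddeev–Popov determinant — typed CONCRETELY in momentum space on cut-off configurations,
# against the tree's Gaussian measure `dν_{ρ₂}(γ)`; the sentence «K_{ρ₂}(A) is well defined since it is a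
# functional integral of a bounded polynomial interaction with a Gaussian measure with ultraviolet cutoff» (p.340)
# KERNEL-CHECKED: `0 < K_{ρ₂} ≤ 1`; (v1.1) `K_{ρ₂}` is continuous in the fields (dominated convergence) and `[K_{ρ₂}]⁻¹ ≥ 1` continuous

statement-level skeleton of published definitions with citation tags; bookkeeping proved; nothing here is a claim
about the Yang–Mills mass gap, about continuum Yang–Mills on `T⁴` without infrared cutoff, or about the Clay problem —
and nothing of Magnen–Rivasseau–Sénéor's analysis is asserted or formalised

**Citation header (reproduction of PUBLISHED work).** J. Magnen, V. Rivasseau, R. Sénéor, *Construction of YM₄ with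
an infrared cutoff*, Commun. Math. Phys. **155** (1993) 325–383 [MagnenRivasseauSeneor1993], Sect. II.C pp.338–340:
(II.32c) p.339 tl.2–3, (II.37)–(II.38) p.339 tl.29–37, p.340 tl.2–14 with (II.39); (II.6) p.329. Loci `p.NNN tl.nn`
= journal page / text-layer line of the held scan `paper:magnen1993-cmp155-mrs-ym4-infrared-cutoff` (PDF page =
journal page − 324); displays read on the decoded page images (renders of record `run/shared/lean/pub/lit-balaban/
inprint/lit-balaban-p14/renders-cmp155/p15_full_s6.png`, `p16_full_s6.png`). Cell pub-balaban-gaps, track G3, seat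
mrs-lit-1 (gen 5); companion prose `run/shared/lean/pub/pub-balaban-gaps/g3/MRS-AS-PRINTED.md` §2, §5. Builds on
`…MRS93AxialYMAction` (`coeff`, `coeffZ`, windows, READING (P), `continuous_cross`), `…MRS93GaussianReferenceMeasures`
(`GhostConfig`, `nu par ρ₂` = `dν_{ρ₂}(γ)` of (II.36)), `…MRS93AnisotropicSlicing` (`Ansatz.indexFinset` = 𝐏,
`Ansatz.backgroundCutoff` = `κ_j` (II.22), `Ansatz.anisoSlice` = `κ^j` (II.21)), `…MRS93MainStatementPinned`
(`Parameters`: `ζ`, `τ, η, M`, `tentativeCoupling`).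

**Why this file.** The seat record lists, among the factors of the bare ansatz (II.78) NOT typed, «K_{ρ,ρ₂} (II.76)»
and «the gauge-fixing factor e^{−(ζ/2)(∇_{B′_l}·A′_s)²} … only as a function of an abstract pair». Their model one
step earlier in the paper — (II.37)/(II.38), the factor `e^{−(ζ/2)(∇_B(A_s,B_l,γ,2))²}` of (II.39) and its
`γ`-average `K_{ρ₂}(A_s, B_l)` — IS definition-complete in print as a function of the three fields `A_s` (small
field), `B_l` (large/background field) and `γ`, up to one item: the «polynomial of high degree»
`e^{−Σ_i((λ_i^t)^{1/2+2ε₂}γ^i)^N}` whose norm convention «(γ^i)^N» the print does not spell out. This file types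
everything else concretely (momentum space, finite windows, the tree's cutoffs `κ_j`, `κ^j` and measure `dν_{ρ₂}`)
and carries the damping polynomial as a NONNEGATIVE MEASURABLE FUNCTIONAL PARAMETER `P` (printed form quoted), which
is all the well-definedness sentence p.340 tl.10–11 uses of it.

**What the paper prints (verbatim, from the page images).**
* p.339 tl.2–3, (II.32c): *«For example B^{rot γ,2} = B − λ[B, γ]. (II.32c)»*; (II.6) p.329: *«A^{γ,2}_μ = A_μ + D_μγ +
  λ/2[γ, ∂_μγ]. (II.6)»*, `D = ∂ − λ[A, ·]`.
* p.339 tl.29–37: *«A Gaussian measure to bound the size of γ is however not sufficient; for technical reasons we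
  need to reinforce its strength by a polynomial of high degree. In order for this polynomial to behave at small γ
  as a small perturbation of a Gaussian measure so that perturbative analysis remains all right, we take this
  polynomial to give a slightly larger size, (λ_i^t)^{−(1/2+2ε₂)}, to γ, (still much smaller than λ⁻¹). Therefore
  we define K_{ρ₂}(A_s, B_l) = ∫ dν_{ρ₂}(γ) e^{−(ζ/2)(∇_B(A_s,B_l,γ,2))²} e^{−Σ_i((λ_i^t)^{1/2+2ε₂}γ^i)^N}, (II.37)
  where N is some large integer, ζ is the number close to 3/13 defining the homothetic gauge, and ∇_B is the
  covariant derivative in the background field, which is defined in the case of our truncated transformations by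
  ∇_B(A_s, B_l, γ, 2) ≡ ∂_μ(A_s^{γ,2})_μ − Σ_j λ[κ_j ∗ (B_l^{rot γ,2})_μ, κ^j ∗ (A_s^{γ,2})_μ], (II.38)»*
* p.340 tl.2–11: *«where the star is a convolution in x-space, and for simplification the Fourier transform of κ^j,
  κ_j … is from now on also noted κ^j, κ_j …. The rotation A^{rot n} is defined in (II.32a–c). From now on we warn
  the reader that most of the time we use simply the notation λ instead of λ_i^t and leave to the reader to
  reconstruct the correct value according to the frequency of the fields concerned; for instance in (II.38), λ
  should be understood as λ_j^t. … K_{ρ₂}(A) is well defined since it is a functional integral of a bounded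
  polynomial interaction with a Gaussian measure with ultraviolet cutoff.»*; tl.12–14, (II.39): *«Then we write
  instead of (II.18) the functional measure of the theory as: Σ_LFR ∫ dμ_{0,ρ₁}(A)dν_{ρ₂}(γ)χ_LFR[K_{ρ₂}(A_s,B_l)]⁻¹ ×
  e^{(1/2)(−F²_sp−⟨A,p₀²A⟩+Σ_iλ²⟨A,(p²κ^i(p))A⟩)} e^{−(ζ/2)(∇_B(A_s,B_l,γ,2))²}. (II.39)»*

**What is typed here (definitions with bodies; bookkeeping kernel-checked, zero `sorry`, zero named facts).**
* §1 coefficient functions on the momentum lattice: `gcoeff`/`gcoeffZ` (Fourier coefficients `γ̃^a(k)` of a `γ`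
  configuration, extended by zero), `convCross U X Y k = Σ_{q,r∈U, q+r=k} X(q) ×₃ Y(r)` (the position-space wedge
  product as a convolution, READING (P)), the momentum boxes `box2 T = T₀ + T₀`, `box4 T = box2 T + box2 T`
  (`T₀ = {0} ∪ T`) carrying the products of two and four cut-off fields, `znorm`/`ztime` (`|k|`, `|k₀|` on `ℤ⁴`).
* §2 (II.6) and (II.32c) in momentum space for cut-off fields given as coefficient functions: `dCoeff`
  (`(∂_μγ)~ = ik_μγ̃`), **`gaugeTrunc2Coeff`** (`(A^{γ,2})~_μ = Ã_μ + ik_μγ̃ − λ(Ã_μ ∗× γ̃) + (λ/2)(γ̃ ∗× (∂_μγ)~)`),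
  **`rotTruncCoeff`** (`(B^{rot γ,2})~_μ = B̃_μ − λ(B̃_μ ∗× γ̃)`).
* §3 **(II.38)**: **`nablaB`** — `∇̃_B(k) = Σ_μ [ik_μ (A_s^{γ,2})~_μ(k) − Σ_{j∈𝐏} λ_j^t Σ_{q+r=k} (κ_j(q)(B_l^{rot γ,2})~_μ(q))
  ×₃ (κ^j(r)(A_s^{γ,2})~_μ(r))]` with the tree's `κ_j = Ansatz.backgroundCutoff`, `κ^j = Ansatz.anisoSlice`, `𝐏 =
  Ansatz.indexFinset`, `λ_j^t = ((λ_i^t)²)^{1/2}` from `Parameters.tentativeCoupling` (p.340 tl.7–8 «in (II.38), λ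
  should be understood as λ_j^t»); **`nablaSq`** = `(∇_B(A_s,B_l,γ,2))² = (1/2)Σ_k Σ_a |∇̃^a_B(k)|²` (Parseval with the
  «factor 1/2 in component notation»); `gfFactor` = `e^{−(ζ/2)(∇_B)²}` with the NAMED `ζ` of `Parameters`.
* §4 **(II.37)**: **`Knorm par … A B P`** = `K_{ρ₂}(A_s, B_l) = ∫ e^{−(ζ/2)(∇_B(A_s,B_l,γ,2))²} e^{−P(γ)} dν_{ρ₂}(γ)`
  against the tree's `nu par ρ₂`, the damping polynomial carried as the functional `P : GhostConfig → ℝ`.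
* §5 PROVED — **p.340 tl.10–11 «K_{ρ₂}(A) is well defined …» KERNEL-CHECKED**: `nablaSq_nonneg`, `gfFactor_pos`,
  `gfFactor_le_one` (`0 ≤ ζ`, the printed region `0 ≤ ζ ≤ 1` of `Parameters.hζ`), `continuous_nablaSq_gamma` (the
  interaction is a polynomial in finitely many coordinates of `γ`), `measurable_kIntegrand`, `kIntegrand_le_one`,
  `integrable_kIntegrand` (bounded measurable against a probability measure), **`Knorm_pos`** and **`Knorm_le_one`**
  (`0 < K_{ρ₂}(A_s,B_l) ≤ 1` for every nonnegative measurable `P`, every window, every `A_s, B_l, ρ₁, ρ₂`), and the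
  normalisation identity behind the factor `[K_{ρ₂}]⁻¹` of (II.39): **`integral_kIntegrand_div_Knorm`**
  (`∫ e^{−(ζ/2)(∇_B)²}e^{−P}/K_{ρ₂} dν_{ρ₂} = 1`).
* §6 (v1.1) PROVED — **`K_{ρ₂}(A_s, B_l)` is jointly CONTINUOUS in the cut-off fields** (`continuous_Knorm`: dominated
  convergence, Mathlib `continuous_of_dominated`, bound `1`), hence Borel measurable (`measurable_Knorm`), and the factor
  `[K_{ρ₂}(A_s, B_l)]⁻¹` of (II.39) is a continuous function `≥ 1` of the fields (`continuous_Knorm_inv`,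
  `one_le_Knorm_inv`) — a legitimate density factor.
* §7 (v1.2) **(II.48)/(II.50) and the (II.78) factor `e^{−(ζ/2)(∇_{B′_l}·A′_s)²}`**: `nablaPrime` = (II.50)
  `∇_{B′_l}·A′_s = ∂_μ(A′_s)_μ − Σ_j λ[κ_j ∗ (B′_l)_μ, κ^j ∗ (A′_s)_μ]` for primed coefficient functions;
  **`nablaB_eq_nablaPrime`** ((II.38) IS (II.50) under the substitution (II.48) `A′_s = A_s^{γ,2}`, `B′_l = B_l^{rot γ,2}`
  — `rfl`); `nablaPrimeSq`, **`gfFactorPrime`** (the fourth-line factor of (II.78) as a function of `(A′_s, B′_l) :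
  Config × Config`), `gfFactorPrime_pos_le_one`, `continuous_gfFactorPrime`, `integrable_gfFactorPrime_muZeroPrime`
  (for each background `B′_l`, integrable against `dμ_{0,ρ₁}(A′)` = the tree's `muZeroPrime`).
* §8 (v1.3) **(II.68) p.344, `U(A′_s, B′_l) ≡ ∂² − λ∂[A′_s, ·] − λΣ_j[κ_j ∗ B′_l, κ^j ∗ ∂·]`** — the operator of «the
  main quadratic piece (ζ/2)(γ′ − γ, UᵗU(γ′ − γ))» — in momentum space as a map on ghost coefficient functions
  (`laplaceCoeff`, `laplaceCoeff_apply` (`(∂²η)~ = −|k|²η̃`), **`uOp`**, `uOpB`/`uOp_eq`); PROVED `uOp_zero_fields`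
  (`U(0,0) = ∂²`), **`uOp_add`**, **`uOp_smul`** (linearity in the ghost field; `convCross_add_right`/`_smul_right`,
  `dCoeff_add`/`_smul`, `laplaceCoeff_add`/`_smul`, `uOpA_add`/`_smul`, `uOpB_add`/`_smul`).
  NOT typed: `UᵗU` («we omit the necessary transpositions of operators», p.344 tl.25–26), `W` (II.70), `Σ` (II.65),
  (II.66), and everything of (II.71)–(II.76).
* §9 (v1.4) **(II.62) `∇_{RB,γ′−γ}`, `D(A′_s)η` ((II.5) on a ghost-type field), (II.69) `V(A′_s, B′_l, γ′ − γ)`** in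
  momentum space (`nablaRB`, `nablaRB_zero_ghost` (= `∇_{B′_l}·` of (II.50) at `γ′ − γ = 0`), `covDCoeff`, `vOp`,
  `vOp_zero_coupling`), and **(II.67) `∇_{RB,γ′−γ} · D(A′_s) = U(A′_s, B′_l) + V(A′_s, B′_l, γ′ − γ)` PROVED EXACTLY AS
  PRINTED** (`nablaRB_covD_eq_uOp_add_vOp`: bilinearity of the printed wedge-product convolution in both factors,
  `convCross_add_left`/`_smul_left`/`_sub_smul_left`/`_sub_smul_right`; each printed `λ²` of (II.69) read as
  `λ_j^t · λ`, READING (R″)).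
* §10 (v1.5) **(II.61)/(II.63)**: `nablaRB_eq_nablaPrime_rot` (`∇_{RB,γ′−γ}` IS the (II.50) shape with background
  `(B′_l)^{rot(γ′−γ),2}`, `rfl`); for generic coefficient functions `X, S, Brot, S′` (the pointwise identities
  (II.56)–(II.60) that produce them are PROVED in `…InfinitesimalGauge` §8) the regrouping (II.61)
  `∇(X + S, Brot + S′) = ∇(X, Brot) + S″` is PROVED (`nablaPrime_reexpand`) with the CORRECTED `S″` (`remS2` = `∂S −
  Σ_j λ[κ_j ∗ S′, κ^j ∗ (X + S)] − Σ_j λ[κ_j ∗ Brot, κ^j ∗ S]`). FINDING (l), kernel-exhibited, not adjudicated: the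
  PRINTED (II.63) (`remS2Printed`) has `(B′_l)^{rot(γ′−γ)} + S′` in its second sum and so counts the cross term
  `Σ_j λ[κ_j ∗ S′, κ^j ∗ S]` twice — `remS2Printed_eq` (`S″_printed = S″ − remS2Cross`) and
  `nablaPrime_reexpand_printed_iff` ((II.61) with the printed `S″` holds iff that term vanishes). `S″` only feeds the
  «small correction term» `Σ` (II.64)/(II.65), so the slip does not touch the argument; recorded as an as-printed
  precision like finding (k) of `…InfinitesimalGauge`.
* §11 (v1.6) **(II.64)/(II.65)** — completing the square in the Parseval reading (P): `sqNormBox` (½ΣΣ|·|²), `dotBox`,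
  **`sigmaCorr`** = (II.65) `Σ = 2S″·(∇_{RB}·X) + (S″)²`, **`sqNormBox_add`** = (II.64) `(∇_{RB}·X + S″)² = (∇_{RB}·X)² + Σ`
  PROVED EXACTLY; `nablaPrimeSq_eq_sqNormBox` (rfl). NOT typed: (II.66) (the `dν_{ρ₂}(γ′)`-integral with these
  exponents), W (II.70), UᵗU, (II.71)–(II.76).

**Readings (declared).** (P), (S) of `…AxialYMAction` (Parseval at unit volume, `∂_μ ↔ ik_μ`, products of fields =
convolutions of coefficients; finite windows). (R″) COUPLINGS: inside `Σ_j` the coupling is `λ_j^t` as the print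
directs (p.340 tl.7–8), typed `((λ_i^t)²)^{1/2}` from the named (II.12) (`Real.sqrt`, `= λ_i^t` where (II.12) is
nonnegative); the `λ` inside `A^{γ,2}`, `B^{rot γ,2}` («according to the frequency of the fields concerned» — not
determined for products of fields of different frequencies) is a free argument `lam`. (Y) DAMPING: the factor
`e^{−Σ_i((λ_i^t)^{1/2+2ε₂}γ^i)^N}` of (II.37) is carried as `e^{−P(γ)}` with `P : GhostConfig → ℝ` a parameter; the
print calls it «a polynomial of high degree» with «N some large integer» («e.g. N = 100», p.347) and does not spell
out the norm hidden in «(γ^i)^N» for the su(2)-valued field `γ^i = κ^i γ` (natural candidate: `∫_Λ (γ^i·γ^i)^{N/2}`);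
the theorems assume only `0 ≤ P` and measurability, which every such reading satisfies for even `N`. (Z) BOXES: the
input fields are coefficient functions supported in a finite momentum box `T` (cut-off fields: `A_s, B_l` below the
fake cutoff, `γ` below `ρ₂`); two-field products are summed over `box2 T`, the four-field bracket of (II.38) and the
Parseval sum over `box4 T`, which contain the supports (complete sums; the containment itself is not re-proved here).
(AA) `|p|` in `κ_j(p)`, `κ^j(p)` = Euclidean norm of the 4-momentum with `|p₀|` the time component (reading (iv) of
`…AnisotropicSlicing`); 𝐏's bottom indices `N_i` a parameter `Nlow` (printed choice `Ansatz.lowIndex`).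

**Honest status / what is NOT claimed.** `K_{ρ₂}` of (II.37) and (v1.2) the factor `e^{−(ζ/2)(∇_{B′_l}·A′_s)²}` of
(II.78) as a function of the free pair `(A′_s, B′_l)` are typed (in (II.78) `B′_l` is determined by the LFR
configuration and `γ` via (II.34)/(II.48) — an input here); the OTHER factor of (II.78) is `[K_{ρ,ρ₂}(A′,γ)]⁻¹`
with `K_{ρ,ρ₂}` of (II.76), «an analogue of K_{ρ₂} … its precise definition is somewhat complicated» (p.340
tl.25–27) — built in (II.51)–(II.76) with the true cutoff on the ghost propagator; NOT typed here. The split `A =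
A_s + B_l` ((II.33)/(II.34)) depends on the large/small field regions (outcome of the expansions) and is an INPUT
here (two free cut-off fields). Nothing is claimed about the size of `K_{ρ₂}` beyond `(0, 1]`, about the change of
variables `A′ = A^{γ,2}` (II.40)–(II.44) (`…TruncatedGauge`, `…InfinitesimalGauge`), about `χ_LFR`, `G(A′,γ)`, `CT_ρ`
(`…CountertermFunctional`), or about the normalisability of (II.39)/(II.78). Nothing here bears on Bałaban's
papers; nothing is continuum YM₄ on `T⁴`, nothing lifts the infrared cutoff, nothing is Clay.
-/

noncomputable section

open MeasureTheory Finset Complex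
open scoped NNReal ENNReal ComplexConjugate Matrix

namespace Literature.MathematicalPhysics.QuantumFieldTheory.MagnenRivasseauSeneor1993

namespace MainStatement

open Ansatz

/-! ## §1 Coefficient functions of `γ`, convolution wedge products, momentum boxes -/

/-- The complex Fourier coefficient `γ̃^a(p)` of a `γ` configuration (real/imaginary coordinates of `GhostConfig`).
[cite: MagnenRivasseauSeneor1993, (II.36) p.339 tl.22–27] -/
def gcoeff (γ : GhostConfig) (p : Momentum) (a : Fin 3) : ℂ :=
  (γ (p, a, false) : ℂ) + (γ (p, a, true) : ℂ) * I

/-- `γ̃` on all of `ℤ⁴`, extended by zero outside the window `S` and at the deleted zero mode.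
[cite: MagnenRivasseauSeneor1993, (II.36) p.339, §II.A p.328 tl.12–15] -/
def gcoeffZ (S : Finset Momentum) (γ : GhostConfig) (k : Fin 4 → ℤ) (a : Fin 3) : ℂ :=
  if h : k = 0 then 0 else if (⟨k, h⟩ : Momentum) ∈ S then gcoeff γ ⟨k, h⟩ a else 0

/-- Each `γ̃^a(p)` is a continuous function of the configuration. [cite: MagnenRivasseauSeneor1993, (II.36) p.339] -/
theorem continuous_gcoeff (p : Momentum) (a : Fin 3) : Continuous fun γ : GhostConfig => gcoeff γ p a := by
  unfold gcoeff
  fun_prop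

/-- … and so is the extension by zero. [cite: MagnenRivasseauSeneor1993, (II.36) p.339] -/
theorem continuous_gcoeffZ (S : Finset Momentum) (k : Fin 4 → ℤ) (a : Fin 3) :
    Continuous fun γ : GhostConfig => gcoeffZ S γ k a := by
  unfold gcoeffZ
  split_ifs
  · exact continuous_const
  · exact continuous_gcoeff _ a
  · exact continuous_const

/-- The position-space wedge product of two su(2)-valued fields as a CONVOLUTION of coefficient functions over the
momentum set `U`: `(X Y)~(k) = Σ_{q,r∈U, q+r=k} X̃(q) ×₃ Ỹ(r)` (READING (P); «the commutator is a wedge product»,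
p.328 tl.32–33). [cite: MagnenRivasseauSeneor1993, §II.A p.328 tl.32–33, (II.38) p.339] -/
def convCross (U : Finset (Fin 4 → ℤ)) (X Y : (Fin 4 → ℤ) → Fin 3 → ℂ) (k : Fin 4 → ℤ) : Fin 3 → ℂ :=
  ∑ q ∈ U, ∑ r ∈ U, if q + r = k then X q ⨯₃ Y r else 0

/-- `T₀ + T₀` with `T₀ = {0} ∪ T`: carries the coefficients of products of two fields cut off at `T` (and `T`
itself). [cite: MagnenRivasseauSeneor1993, §II.A p.328 tl.12–15, (II.38) p.339] -/
def box2 (T : Finset (Fin 4 → ℤ)) : Finset (Fin 4 → ℤ) :=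
  Finset.image₂ (· + ·) (insert 0 T) (insert 0 T)

/-- `box2 T + box2 T`: carries products of up to four fields cut off at `T` (READING (Z)).
[cite: MagnenRivasseauSeneor1993, (II.38) p.339] -/
def box4 (T : Finset (Fin 4 → ℤ)) : Finset (Fin 4 → ℤ) :=
  Finset.image₂ (· + ·) (box2 T) (box2 T)

/-- `|k|` on `ℤ⁴` (Euclidean norm of the 4-momentum; READING (AA)). [cite: MagnenRivasseauSeneor1993, (II.13) p.331, (II.21) p.335] -/
def znorm (k : Fin 4 → ℤ) : ℝ := Real.sqrt (∑ μ, ((k μ : ℤ) : ℝ) ^ 2)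

/-- `|k₀|` on `ℤ⁴` (the time component, p.328 tl.19). [cite: MagnenRivasseauSeneor1993, (II.21) p.335] -/
def ztime (k : Fin 4 → ℤ) : ℝ := |((k 0 : ℤ) : ℝ)|

/-! ## §2 (II.6) `A^{γ,2}` and (II.32c) `B^{rot γ,2}` in momentum space -/

/-- `(∂_μγ)~(k) = ik_μ γ̃(k)` (READING (P)). [cite: MagnenRivasseauSeneor1993, (II.6) p.329] -/
def dCoeff (X : (Fin 4 → ℤ) → Fin 3 → ℂ) (μ : Fin 4) (k : Fin 4 → ℤ) : Fin 3 → ℂ :=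
  fun a => I * ((k μ : ℤ) : ℂ) * X k a

/-- **(II.6) in momentum space**: `(A^{γ,2})~_μ(k) = Ã_μ(k) + ik_μγ̃(k) − λ Σ_{q+r=k} Ã_μ(q) ×₃ γ̃(r) + (λ/2) Σ_{q+r=k}
γ̃(q) ×₃ (ir_μγ̃(r))` — `A_μ + D_μγ + (λ/2)[γ, ∂_μγ]` with `D_μγ = ∂_μγ − λ[A_μ, γ]`, for cut-off fields given by
coefficient functions supported in `T` (convolutions over `T₀ = {0} ∪ T`).
[cite: MagnenRivasseauSeneor1993, (II.6) p.329 tl.16, (II.5) p.329] -/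
def gaugeTrunc2Coeff (T : Finset (Fin 4 → ℤ)) (lam : ℝ) (A : (Fin 4 → ℤ) → Fin 4 → Fin 3 → ℂ)
    (G : (Fin 4 → ℤ) → Fin 3 → ℂ) (μ : Fin 4) (k : Fin 4 → ℤ) : Fin 3 → ℂ :=
  (fun a => A k μ a) + dCoeff G μ k - (lam : ℂ) • convCross (insert 0 T) (fun q => A q μ) G k +
    ((lam / 2 : ℝ) : ℂ) • convCross (insert 0 T) G (dCoeff G μ) k

/-- **(II.32c) in momentum space**: `(B^{rot γ,2})~_μ(k) = B̃_μ(k) − λ Σ_{q+r=k} B̃_μ(q) ×₃ γ̃(r)` — «B^{rot γ,2} = B −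
λ[B, γ]». [cite: MagnenRivasseauSeneor1993, (II.32c) p.339 tl.2–3] -/
def rotTruncCoeff (T : Finset (Fin 4 → ℤ)) (lam : ℝ) (B : (Fin 4 → ℤ) → Fin 4 → Fin 3 → ℂ)
    (G : (Fin 4 → ℤ) → Fin 3 → ℂ) (μ : Fin 4) (k : Fin 4 → ℤ) : Fin 3 → ℂ :=
  (fun a => B k μ a) - (lam : ℂ) • convCross (insert 0 T) (fun q => B q μ) G k

/-! ## §3 (II.38) `∇_B(A_s, B_l, γ, 2)`, its square, and the gauge-fixing factor -/

variable (par : Parameters) (Nlow : ℕ → ℕ)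

/-- `λ_j^t = ((λ_i^t)²)^{1/2}` for `j = (i, α)`, from the named (II.12) (READING (R″)).
[cite: MagnenRivasseauSeneor1993, (II.12) p.330, p.340 tl.7–8] -/
def Parameters.sliceCoupling (j : ℕ × ℕ) : ℝ := Real.sqrt (par.tentativeCoupling j.1)

/-- `κ_j(k)` on `ℤ⁴`: the background cutoff (II.22) of the tree at `(|k|, |k₀|)`.
[cite: MagnenRivasseauSeneor1993, (II.22) p.335, (II.38) p.339] -/
def Parameters.kappaLow (ρ₁ : ℕ) (j : ℕ × ℕ) (k : Fin 4 → ℤ) : ℝ :=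
  backgroundCutoff par.τ par.η par.M Nlow ρ₁ j (znorm k) (ztime k)

/-- `κ^j(k)` on `ℤ⁴`: the anisotropic slice (II.21) of the tree at `(|k|, |k₀|)`.
[cite: MagnenRivasseauSeneor1993, (II.21) p.335, (II.38) p.339] -/
def Parameters.kappaSlice (j : ℕ × ℕ) (k : Fin 4 → ℤ) : ℝ :=
  anisoSlice par.τ par.η par.M (Nlow j.1) j.1 j.2 (znorm k) (ztime k)

/-- **(II.38), `∇_B(A_s, B_l, γ, 2)` in momentum space** (colour vector at lattice momentum `k`):
`∇̃_B(k) = Σ_μ [ ik_μ (A_s^{γ,2})~_μ(k) − Σ_{j∈𝐏} λ_j^t Σ_{q+r=k} (κ_j(q)(B_l^{rot γ,2})~_μ(q)) ×₃ (κ^j(r)(A_s^{γ,2})~_μ(r)) ]`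
— «∂_μ(A_s^{γ,2})_μ − Σ_j λ[κ_j ∗ (B_l^{rot γ,2})_μ, κ^j ∗ (A_s^{γ,2})_μ]» with the stars read as momentum
multipliers (p.340 tl.2–3), the tree's `κ_j`/`κ^j`/𝐏, and `λ = λ_j^t` inside the sum (p.340 tl.7–8).
[cite: MagnenRivasseauSeneor1993, (II.38) p.339 tl.37, p.340 tl.2–8] -/
def nablaB (T : Finset (Fin 4 → ℤ)) (ρ₁ : ℕ) (lam : ℝ) (A B : (Fin 4 → ℤ) → Fin 4 → Fin 3 → ℂ)
    (G : (Fin 4 → ℤ) → Fin 3 → ℂ) (k : Fin 4 → ℤ) : Fin 3 → ℂ :=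
  ∑ μ, (dCoeff (fun k' => gaugeTrunc2Coeff T lam A G μ k') μ k -
    ∑ j ∈ indexFinset Nlow ρ₁, ((par.sliceCoupling j : ℝ) : ℂ) •
      convCross (box2 T) (fun q => ((par.kappaLow Nlow ρ₁ j q : ℝ) : ℂ) • rotTruncCoeff T lam B G μ q)
        (fun r => ((par.kappaSlice Nlow j r : ℝ) : ℂ) • gaugeTrunc2Coeff T lam A G μ r) k)

/-- **`(∇_B(A_s, B_l, γ, 2))²`** = `∫_Λ` of the square of the su(2)-valued scalar `∇_B` with the print's «factor 1/2 in
component notation»: by Parseval `(1/2) Σ_{k∈box4 T} Σ_a |∇̃^a_B(k)|²` (READINGS (P), (Z)).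
[cite: MagnenRivasseauSeneor1993, (II.37) p.339 tl.34, p.328 tl.37–41] -/
def nablaSq (T : Finset (Fin 4 → ℤ)) (ρ₁ : ℕ) (lam : ℝ) (A B : (Fin 4 → ℤ) → Fin 4 → Fin 3 → ℂ)
    (G : (Fin 4 → ℤ) → Fin 3 → ℂ) : ℝ :=
  (1 / 2) * ∑ k ∈ box4 T, ∑ a, normSq (nablaB par Nlow T ρ₁ lam A B G k a)

/-- `(∇_B)² ≥ 0`. [cite: MagnenRivasseauSeneor1993, (II.37) p.339] -/
theorem nablaSq_nonneg (T : Finset (Fin 4 → ℤ)) (ρ₁ : ℕ) (lam : ℝ) (A B : (Fin 4 → ℤ) → Fin 4 → Fin 3 → ℂ)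
    (G : (Fin 4 → ℤ) → Fin 3 → ℂ) : 0 ≤ nablaSq par Nlow T ρ₁ lam A B G :=
  mul_nonneg (by norm_num) (sum_nonneg fun _ _ => sum_nonneg fun _ _ => normSq_nonneg _)

/-- The three cut-off fields of (II.37)/(II.38) as coefficient functions: `A_s`, `B_l` from configurations on the
window `S` (the tree's `coeffZ`), `γ` from a `GhostConfig` on the window `Sγ` (`gcoeffZ`); the momentum box `T` =
the union of the underlying lattice points. [cite: MagnenRivasseauSeneor1993, (II.33)–(II.34) p.339, (II.36) p.339] -/
def momentumBox (S Sγ : Finset Momentum) : Finset (Fin 4 → ℤ) := (S ∪ Sγ).image Subtype.val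

/-- **`(∇_B(A_s, B_l, γ, 2))²` on configurations**: `A_s, B_l : Config` cut off at `S`, `γ : GhostConfig` cut off at
`Sγ`. [cite: MagnenRivasseauSeneor1993, (II.37)–(II.38) p.339] -/
def nablaSqConfig (S Sγ : Finset Momentum) (ρ₁ : ℕ) (lam : ℝ) (A B : Config) (γ : GhostConfig) : ℝ :=
  nablaSq par Nlow (momentumBox S Sγ) ρ₁ lam (coeffZ S A) (coeffZ S B) (gcoeffZ Sγ γ)

/-- **The gauge-fixing factor `e^{−(ζ/2)(∇_B(A_s,B_l,γ,2))²}`** of (II.37)/(II.39), with the NAMED homothetic-gauge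
parameter `ζ` of `Parameters`. [cite: MagnenRivasseauSeneor1993, (II.37) p.339 tl.34, (II.39) p.340 tl.14] -/
def gfFactor (S Sγ : Finset Momentum) (ρ₁ : ℕ) (lam : ℝ) (A B : Config) (γ : GhostConfig) : ℝ :=
  Real.exp (-(par.ζ / 2) * nablaSqConfig par Nlow S Sγ ρ₁ lam A B γ)

/-- `e^{−(ζ/2)(∇_B)²} > 0`. [cite: MagnenRivasseauSeneor1993, (II.37) p.339] -/
theorem gfFactor_pos (S Sγ : Finset Momentum) (ρ₁ : ℕ) (lam : ℝ) (A B : Config) (γ : GhostConfig) :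
    0 < gfFactor par Nlow S Sγ ρ₁ lam A B γ := Real.exp_pos _

/-- `e^{−(ζ/2)(∇_B)²} ≤ 1` — `ζ ≥ 0` is the printed region «0 ≤ ζ ≤ 1» (p.374 tl.2) carried by `Parameters.hζ`.
[cite: MagnenRivasseauSeneor1993, (II.37) p.339, p.374 tl.2] -/
theorem gfFactor_le_one (S Sγ : Finset Momentum) (ρ₁ : ℕ) (lam : ℝ) (A B : Config) (γ : GhostConfig) :
    gfFactor par Nlow S Sγ ρ₁ lam A B γ ≤ 1 := by
  unfold gfFactor
  rw [Real.exp_le_one_iff]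
  have h1 := par.hζ.1
  have h2 := nablaSq_nonneg par Nlow (momentumBox S Sγ) ρ₁ lam (coeffZ S A) (coeffZ S B) (gcoeffZ Sγ γ)
  unfold nablaSqConfig
  nlinarith

/-! ## §4 (II.37) `K_{ρ₂}(A_s, B_l)` against the tree's `dν_{ρ₂}(γ)` -/

/-- The integrand of (II.37): `e^{−(ζ/2)(∇_B(A_s,B_l,γ,2))²} e^{−P(γ)}`, the damping «polynomial of high degree» carried
as the functional `P` (READING (Y)). [cite: MagnenRivasseauSeneor1993, (II.37) p.339 tl.29–34] -/
def kIntegrand (S Sγ : Finset Momentum) (ρ₁ : ℕ) (lam : ℝ) (A B : Config) (P : GhostConfig → ℝ)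
    (γ : GhostConfig) : ℝ :=
  Real.exp (-(par.ζ / 2) * nablaSqConfig par Nlow S Sγ ρ₁ lam A B γ - P γ)

/-- The integrand is the product of the two printed exponential factors.
[cite: MagnenRivasseauSeneor1993, (II.37) p.339 tl.34] -/
theorem kIntegrand_eq (S Sγ : Finset Momentum) (ρ₁ : ℕ) (lam : ℝ) (A B : Config) (P : GhostConfig → ℝ)
    (γ : GhostConfig) :
    kIntegrand par Nlow S Sγ ρ₁ lam A B P γ = gfFactor par Nlow S Sγ ρ₁ lam A B γ * Real.exp (-P γ) := by
  unfold kIntegrand gfFactor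
  rw [← Real.exp_add]
  ring_nf

/-- **(II.37), `K_{ρ₂}(A_s, B_l) = ∫ dν_{ρ₂}(γ) e^{−(ζ/2)(∇_B(A_s,B_l,γ,2))²} e^{−P(γ)}`** against the tree's Gaussian
measure `nu par ρ₂` of (II.36) (READINGS (Y), (Z)). [cite: MagnenRivasseauSeneor1993, (II.37) p.339 tl.34] -/
def Knorm (S Sγ : Finset Momentum) (ρ₁ ρ₂ : ℕ) (lam : ℝ) (A B : Config) (P : GhostConfig → ℝ) : ℝ :=
  ∫ γ, kIntegrand par Nlow S Sγ ρ₁ lam A B P γ ∂(nu par ρ₂)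

/-! ## §5 «K_{ρ₂}(A) is well defined since it is a functional integral of a bounded polynomial interaction with a
Gaussian measure with ultraviolet cutoff» (p.340 tl.10–11) — KERNEL-CHECKED: `0 < K_{ρ₂} ≤ 1` -/

/-- The convolution wedge product is continuous in its two (function-valued) arguments, pointwise in `k`.
[cite: MagnenRivasseauSeneor1993, §II.A p.328 tl.32–33] -/
theorem continuous_convCross {X : Type*} [TopologicalSpace X] (U : Finset (Fin 4 → ℤ))
    {F G : X → (Fin 4 → ℤ) → Fin 3 → ℂ} (hF : ∀ q, Continuous fun x => F x q)
    (hG : ∀ r, Continuous fun x => G x r) (k : Fin 4 → ℤ) :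
    Continuous fun x => convCross U (F x) (G x) k := by
  unfold convCross
  refine continuous_finsetSum _ fun q _ => continuous_finsetSum _ fun r _ => ?_
  split_ifs
  · exact continuous_cross (hF q) (hG r)
  · exact continuous_const

/-- `γ ↦ γ̃` (extended by zero) is continuous as a function into colour vectors, pointwise in `k`.
[cite: MagnenRivasseauSeneor1993, (II.36) p.339] -/
theorem continuous_gcoeffZ_vec (Sγ : Finset Momentum) (k : Fin 4 → ℤ) :
    Continuous fun γ : GhostConfig => gcoeffZ Sγ γ k :=
  continuous_pi fun a => continuous_gcoeffZ Sγ k a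

/-- `γ ↦ (∂_μγ)~(k)` is continuous. [cite: MagnenRivasseauSeneor1993, (II.6) p.329] -/
theorem continuous_dCoeff_gamma (Sγ : Finset Momentum) (μ : Fin 4) (k : Fin 4 → ℤ) :
    Continuous fun γ : GhostConfig => dCoeff (gcoeffZ Sγ γ) μ k := by
  refine continuous_pi fun a => ?_
  unfold dCoeff
  exact continuous_const.mul (continuous_gcoeffZ Sγ k a)

/-- For fixed `A_s`, `γ ↦ (A_s^{γ,2})~_μ(k)` is continuous (a polynomial in finitely many coordinates of `γ`).
[cite: MagnenRivasseauSeneor1993, (II.6) p.329] -/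
theorem continuous_gaugeTrunc2Coeff_gamma (T : Finset (Fin 4 → ℤ)) (lam : ℝ)
    (A : (Fin 4 → ℤ) → Fin 4 → Fin 3 → ℂ) (Sγ : Finset Momentum) (μ : Fin 4) (k : Fin 4 → ℤ) :
    Continuous fun γ : GhostConfig => gaugeTrunc2Coeff T lam A (gcoeffZ Sγ γ) μ k := by
  unfold gaugeTrunc2Coeff
  have h1 : Continuous fun γ : GhostConfig => convCross (insert 0 T) (fun q => A q μ) (gcoeffZ Sγ γ) k :=
    continuous_convCross (insert 0 T) (F := fun (_ : GhostConfig) q => A q μ) (G := fun γ q => gcoeffZ Sγ γ q)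
      (fun q => continuous_const) (fun r => continuous_gcoeffZ_vec Sγ r) k
  have h2 : Continuous fun γ : GhostConfig => convCross (insert 0 T) (gcoeffZ Sγ γ) (dCoeff (gcoeffZ Sγ γ) μ) k :=
    continuous_convCross (insert 0 T) (F := fun γ q => gcoeffZ Sγ γ q) (G := fun γ r => dCoeff (gcoeffZ Sγ γ) μ r)
      (fun q => continuous_gcoeffZ_vec Sγ q) (fun r => continuous_dCoeff_gamma Sγ μ r) k
  have h1' : Continuous fun γ : GhostConfig => (lam : ℂ) • convCross (insert 0 T) (fun q => A q μ) (gcoeffZ Sγ γ) k :=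
    (continuous_const_smul _).comp h1
  have h2' : Continuous fun γ : GhostConfig =>
      ((lam / 2 : ℝ) : ℂ) • convCross (insert 0 T) (gcoeffZ Sγ γ) (dCoeff (gcoeffZ Sγ γ) μ) k :=
    (continuous_const_smul _).comp h2
  exact ((continuous_const.add (continuous_dCoeff_gamma Sγ μ k)).sub h1').add h2'

/-- For fixed `B_l`, `γ ↦ (B_l^{rot γ,2})~_μ(k)` is continuous. [cite: MagnenRivasseauSeneor1993, (II.32c) p.339] -/
theorem continuous_rotTruncCoeff_gamma (T : Finset (Fin 4 → ℤ)) (lam : ℝ)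
    (B : (Fin 4 → ℤ) → Fin 4 → Fin 3 → ℂ) (Sγ : Finset Momentum) (μ : Fin 4) (k : Fin 4 → ℤ) :
    Continuous fun γ : GhostConfig => rotTruncCoeff T lam B (gcoeffZ Sγ γ) μ k := by
  unfold rotTruncCoeff
  have h1 : Continuous fun γ : GhostConfig => convCross (insert 0 T) (fun q => B q μ) (gcoeffZ Sγ γ) k :=
    continuous_convCross (insert 0 T) (F := fun (_ : GhostConfig) q => B q μ) (G := fun γ q => gcoeffZ Sγ γ q)
      (fun q => continuous_const) (fun r => continuous_gcoeffZ_vec Sγ r) k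
  exact continuous_const.sub ((continuous_const_smul _).comp h1)

/-- For fixed `A_s, B_l`, `γ ↦ ∇̃_B(k)` is continuous. [cite: MagnenRivasseauSeneor1993, (II.38) p.339] -/
theorem continuous_nablaB_gamma (T : Finset (Fin 4 → ℤ)) (ρ₁ : ℕ) (lam : ℝ)
    (A B : (Fin 4 → ℤ) → Fin 4 → Fin 3 → ℂ) (Sγ : Finset Momentum) (k : Fin 4 → ℤ) :
    Continuous fun γ : GhostConfig => nablaB par Nlow T ρ₁ lam A B (gcoeffZ Sγ γ) k := by
  unfold nablaB
  refine continuous_finsetSum _ fun μ _ => Continuous.sub ?_ ?_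
  · refine continuous_pi fun a => ?_
    unfold dCoeff
    exact continuous_const.mul
      ((continuous_apply a).comp (continuous_gaugeTrunc2Coeff_gamma T lam A Sγ μ k))
  · refine continuous_finsetSum _ fun j _ => ?_
    have h : Continuous fun γ : GhostConfig =>
        convCross (box2 T) (fun q => ((par.kappaLow Nlow ρ₁ j q : ℝ) : ℂ) • rotTruncCoeff T lam B (gcoeffZ Sγ γ) μ q)
          (fun r => ((par.kappaSlice Nlow j r : ℝ) : ℂ) • gaugeTrunc2Coeff T lam A (gcoeffZ Sγ γ) μ r) k :=
      continuous_convCross (box2 T)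
        (F := fun γ q => ((par.kappaLow Nlow ρ₁ j q : ℝ) : ℂ) • rotTruncCoeff T lam B (gcoeffZ Sγ γ) μ q)
        (G := fun γ r => ((par.kappaSlice Nlow j r : ℝ) : ℂ) • gaugeTrunc2Coeff T lam A (gcoeffZ Sγ γ) μ r)
        (fun q => (continuous_const_smul _).comp (continuous_rotTruncCoeff_gamma T lam B Sγ μ q))
        (fun r => (continuous_const_smul _).comp (continuous_gaugeTrunc2Coeff_gamma T lam A Sγ μ r)) k
    exact (continuous_const_smul _).comp h

/-- **The interaction `(∇_B(A_s,B_l,γ,2))²` is a continuous (polynomial) function of the cut-off `γ`** — the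
«bounded polynomial interaction» of p.340 tl.10–11 is `e^{−(ζ/2)·(this)}`.
[cite: MagnenRivasseauSeneor1993, (II.37)–(II.38) p.339, p.340 tl.10–11] -/
theorem continuous_nablaSq_gamma (S Sγ : Finset Momentum) (ρ₁ : ℕ) (lam : ℝ) (A B : Config) :
    Continuous fun γ : GhostConfig => nablaSqConfig par Nlow S Sγ ρ₁ lam A B γ := by
  unfold nablaSqConfig nablaSq
  refine continuous_const.mul (continuous_finsetSum _ fun k _ => continuous_finsetSum _ fun a _ => ?_)
  exact Complex.continuous_normSq.comp ((continuous_apply a).comp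
    (continuous_nablaB_gamma par Nlow (momentumBox S Sγ) ρ₁ lam (coeffZ S A) (coeffZ S B) Sγ k))

/-- The gauge-fixing factor is continuous in `γ`. [cite: MagnenRivasseauSeneor1993, (II.37) p.339] -/
theorem continuous_gfFactor_gamma (S Sγ : Finset Momentum) (ρ₁ : ℕ) (lam : ℝ) (A B : Config) :
    Continuous fun γ : GhostConfig => gfFactor par Nlow S Sγ ρ₁ lam A B γ :=
  Real.continuous_exp.comp (continuous_const.mul (continuous_nablaSq_gamma par Nlow S Sγ ρ₁ lam A B))

/-- The integrand of (II.37) is measurable in `γ` for every measurable damping functional `P`.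
[cite: MagnenRivasseauSeneor1993, (II.37) p.339, p.340 tl.10–11] -/
theorem measurable_kIntegrand (S Sγ : Finset Momentum) (ρ₁ : ℕ) (lam : ℝ) (A B : Config)
    {P : GhostConfig → ℝ} (hP : Measurable P) :
    Measurable fun γ => kIntegrand par Nlow S Sγ ρ₁ lam A B P γ := by
  unfold kIntegrand
  exact Real.measurable_exp.comp
    (((continuous_const.mul (continuous_nablaSq_gamma par Nlow S Sγ ρ₁ lam A B)).measurable).sub hP)

/-- The integrand is positive … [cite: MagnenRivasseauSeneor1993, (II.37) p.339] -/
theorem kIntegrand_pos (S Sγ : Finset Momentum) (ρ₁ : ℕ) (lam : ℝ) (A B : Config) (P : GhostConfig → ℝ)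
    (γ : GhostConfig) : 0 < kIntegrand par Nlow S Sγ ρ₁ lam A B P γ := Real.exp_pos _

/-- … and BOUNDED BY ONE for a nonnegative damping functional («bounded polynomial interaction», p.340 tl.10).
[cite: MagnenRivasseauSeneor1993, (II.37) p.339, p.340 tl.10–11] -/
theorem kIntegrand_le_one (S Sγ : Finset Momentum) (ρ₁ : ℕ) (lam : ℝ) (A B : Config) {P : GhostConfig → ℝ}
    (hP : ∀ γ, 0 ≤ P γ) (γ : GhostConfig) : kIntegrand par Nlow S Sγ ρ₁ lam A B P γ ≤ 1 := by
  rw [kIntegrand_eq]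
  have h1 := gfFactor_le_one par Nlow S Sγ ρ₁ lam A B γ
  have h2 := (gfFactor_pos par Nlow S Sγ ρ₁ lam A B γ).le
  have h3 : Real.exp (-P γ) ≤ 1 := Real.exp_le_one_iff.mpr (by linarith [hP γ])
  have h4 := (Real.exp_pos (-P γ)).le
  calc gfFactor par Nlow S Sγ ρ₁ lam A B γ * Real.exp (-P γ) ≤ 1 * 1 :=
        mul_le_mul h1 h3 h4 zero_le_one
    _ = 1 := one_mul 1

/-- Hence the integrand is INTEGRABLE against the probability measure `dν_{ρ₂}` («… with a Gaussian measure with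
ultraviolet cutoff», p.340 tl.10–11). [cite: MagnenRivasseauSeneor1993, (II.36)–(II.37) p.339, p.340 tl.10–11] -/
theorem integrable_kIntegrand (S Sγ : Finset Momentum) (ρ₁ ρ₂ : ℕ) (lam : ℝ) (A B : Config)
    {P : GhostConfig → ℝ} (hP : ∀ γ, 0 ≤ P γ) (hPm : Measurable P) :
    Integrable (fun γ => kIntegrand par Nlow S Sγ ρ₁ lam A B P γ) (nu par ρ₂) := by
  refine Integrable.of_bound (C := 1) (measurable_kIntegrand par Nlow S Sγ ρ₁ lam A B hPm).aestronglyMeasurable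
    (Filter.Eventually.of_forall fun γ => ?_)
  rw [Real.norm_eq_abs, abs_of_pos (kIntegrand_pos par Nlow S Sγ ρ₁ lam A B P γ)]
  exact kIntegrand_le_one par Nlow S Sγ ρ₁ lam A B hP γ

/-- **`K_{ρ₂}(A_s, B_l) > 0`** — the factor `[K_{ρ₂}(A_s,B_l)]⁻¹` of (II.39) is a real number.
[cite: MagnenRivasseauSeneor1993, (II.37) p.339, (II.39) p.340, p.340 tl.10–11] -/
theorem Knorm_pos (S Sγ : Finset Momentum) (ρ₁ ρ₂ : ℕ) (lam : ℝ) (A B : Config) {P : GhostConfig → ℝ}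
    (hP : ∀ γ, 0 ≤ P γ) (hPm : Measurable P) : 0 < Knorm par Nlow S Sγ ρ₁ ρ₂ lam A B P := by
  unfold Knorm kIntegrand
  exact integral_exp_pos (by
    have h := integrable_kIntegrand par Nlow S Sγ ρ₁ ρ₂ lam A B hP hPm
    unfold kIntegrand at h
    exact h)

/-- **`K_{ρ₂}(A_s, B_l) ≤ 1`** — «well defined since it is a functional integral of a bounded polynomial interaction
with a Gaussian measure with ultraviolet cutoff» (p.340 tl.10–11): for every nonnegative measurable damping
functional, every pair of windows, all `A_s, B_l, ρ₁, ρ₂`, every coupling.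
[cite: MagnenRivasseauSeneor1993, (II.37) p.339, p.340 tl.10–11] -/
theorem Knorm_le_one (S Sγ : Finset Momentum) (ρ₁ ρ₂ : ℕ) (lam : ℝ) (A B : Config) {P : GhostConfig → ℝ}
    (hP : ∀ γ, 0 ≤ P γ) : Knorm par Nlow S Sγ ρ₁ ρ₂ lam A B P ≤ 1 := by
  unfold Knorm
  haveI : IsProbabilityMeasure (nu par ρ₂) := inferInstance
  calc ∫ γ, kIntegrand par Nlow S Sγ ρ₁ lam A B P γ ∂(nu par ρ₂)
      ≤ ∫ _γ, (1 : ℝ) ∂(nu par ρ₂) := by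
        refine integral_mono_of_nonneg (Filter.Eventually.of_forall fun γ => (kIntegrand_pos par Nlow S Sγ ρ₁
          lam A B P γ).le) (integrable_const 1) (Filter.Eventually.of_forall fun γ => ?_)
        exact kIntegrand_le_one par Nlow S Sγ ρ₁ lam A B hP γ
    _ = 1 := by simp

/-- **The normalisation behind the factor `[K_{ρ₂}]⁻¹` of (II.39)**: the `γ`-integral of the gauge-fixing weight
divided by `K_{ρ₂}` is exactly `1` — the cut-off analogue of inserting «1» via the Faddeev–Popov formula (II.20)
(p.333 tl.32–33 «we will use an approximation to (II.20) which amounts no longer to insert 1 but to insert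
cutoffs»). [cite: MagnenRivasseauSeneor1993, (II.37) p.339, (II.39) p.340 tl.12–14, (II.20) p.333] -/
theorem integral_kIntegrand_div_Knorm (S Sγ : Finset Momentum) (ρ₁ ρ₂ : ℕ) (lam : ℝ) (A B : Config)
    {P : GhostConfig → ℝ} (hP : ∀ γ, 0 ≤ P γ) (hPm : Measurable P) :
    ∫ γ, kIntegrand par Nlow S Sγ ρ₁ lam A B P γ / Knorm par Nlow S Sγ ρ₁ ρ₂ lam A B P ∂(nu par ρ₂) = 1 := by
  have hK := Knorm_pos par Nlow S Sγ ρ₁ ρ₂ lam A B hP hPm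
  simp_rw [div_eq_mul_inv]
  rw [integral_mul_const]
  unfold Knorm at hK ⊢
  exact mul_inv_cancel₀ hK.ne'

/-! ## §6 (v1.1) `K_{ρ₂}(A_s, B_l)` is a CONTINUOUS function of the cut-off fields (dominated convergence with
the bound `1`), so `[K_{ρ₂}(A_s, B_l)]⁻¹` in (II.39) is a continuous, positive, measurable density factor -/

/-- For fixed `γ`, `A ↦ (A^{γ,2})~_μ(k)` is continuous in the cut-off field `A` (a polynomial in finitely many of its
coordinates). [cite: MagnenRivasseauSeneor1993, (II.6) p.329] -/
theorem continuous_gaugeTrunc2Coeff_field (T : Finset (Fin 4 → ℤ)) (lam : ℝ) (S : Finset Momentum)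
    (G : (Fin 4 → ℤ) → Fin 3 → ℂ) (μ : Fin 4) (k : Fin 4 → ℤ) :
    Continuous fun A : Config => gaugeTrunc2Coeff T lam (coeffZ S A) G μ k := by
  unfold gaugeTrunc2Coeff
  have h0 : Continuous fun A : Config => (fun a => coeffZ S A k μ a) :=
    continuous_pi fun a => continuous_coeffZ S k μ a
  have h1 : Continuous fun A : Config => convCross (insert 0 T) (fun q => coeffZ S A q μ) G k :=
    continuous_convCross (insert 0 T) (F := fun (A : Config) q => coeffZ S A q μ) (G := fun _ q => G q)
      (fun q => continuous_pi fun a => continuous_coeffZ S q μ a) (fun r => continuous_const) k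
  exact ((h0.add continuous_const).sub ((continuous_const_smul _).comp h1)).add continuous_const

/-- For fixed `γ`, `B ↦ (B^{rot γ,2})~_μ(k)` is continuous in the cut-off field `B`. [cite: MagnenRivasseauSeneor1993, (II.32c) p.339] -/
theorem continuous_rotTruncCoeff_field (T : Finset (Fin 4 → ℤ)) (lam : ℝ) (S : Finset Momentum)
    (G : (Fin 4 → ℤ) → Fin 3 → ℂ) (μ : Fin 4) (k : Fin 4 → ℤ) :
    Continuous fun B : Config => rotTruncCoeff T lam (coeffZ S B) G μ k := by
  unfold rotTruncCoeff
  have h0 : Continuous fun B : Config => (fun a => coeffZ S B k μ a) :=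
    continuous_pi fun a => continuous_coeffZ S k μ a
  have h1 : Continuous fun B : Config => convCross (insert 0 T) (fun q => coeffZ S B q μ) G k :=
    continuous_convCross (insert 0 T) (F := fun (B : Config) q => coeffZ S B q μ) (G := fun _ q => G q)
      (fun q => continuous_pi fun a => continuous_coeffZ S q μ a) (fun r => continuous_const) k
  exact h0.sub ((continuous_const_smul _).comp h1)

/-- For fixed `γ`, `(A_s, B_l) ↦ ∇̃_B(k)` is continuous in the pair of cut-off fields.
[cite: MagnenRivasseauSeneor1993, (II.38) p.339] -/
theorem continuous_nablaB_fields (T : Finset (Fin 4 → ℤ)) (ρ₁ : ℕ) (lam : ℝ) (S : Finset Momentum)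
    (G : (Fin 4 → ℤ) → Fin 3 → ℂ) (k : Fin 4 → ℤ) :
    Continuous fun AB : Config × Config => nablaB par Nlow T ρ₁ lam (coeffZ S AB.1) (coeffZ S AB.2) G k := by
  unfold nablaB
  refine continuous_finsetSum _ fun μ _ => Continuous.sub ?_ ?_
  · refine continuous_pi fun a => ?_
    unfold dCoeff
    exact continuous_const.mul ((continuous_apply a).comp
      ((continuous_gaugeTrunc2Coeff_field T lam S G μ k).comp continuous_fst))
  · refine continuous_finsetSum _ fun j _ => ?_
    have h : Continuous fun AB : Config × Config =>
        convCross (box2 T) (fun q => ((par.kappaLow Nlow ρ₁ j q : ℝ) : ℂ) • rotTruncCoeff T lam (coeffZ S AB.2) G μ q)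
          (fun r => ((par.kappaSlice Nlow j r : ℝ) : ℂ) • gaugeTrunc2Coeff T lam (coeffZ S AB.1) G μ r) k :=
      continuous_convCross (box2 T)
        (F := fun (AB : Config × Config) q =>
          ((par.kappaLow Nlow ρ₁ j q : ℝ) : ℂ) • rotTruncCoeff T lam (coeffZ S AB.2) G μ q)
        (G := fun (AB : Config × Config) r =>
          ((par.kappaSlice Nlow j r : ℝ) : ℂ) • gaugeTrunc2Coeff T lam (coeffZ S AB.1) G μ r)
        (fun q => (continuous_const_smul _).comp ((continuous_rotTruncCoeff_field T lam S G μ q).comp continuous_snd))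
        (fun r => (continuous_const_smul _).comp
          ((continuous_gaugeTrunc2Coeff_field T lam S G μ r).comp continuous_fst)) k
    exact (continuous_const_smul _).comp h

/-- For fixed `γ`, `(A_s, B_l) ↦ (∇_B(A_s,B_l,γ,2))²` is continuous. [cite: MagnenRivasseauSeneor1993, (II.37)–(II.38) p.339] -/
theorem continuous_nablaSq_fields (S Sγ : Finset Momentum) (ρ₁ : ℕ) (lam : ℝ) (γ : GhostConfig) :
    Continuous fun AB : Config × Config => nablaSqConfig par Nlow S Sγ ρ₁ lam AB.1 AB.2 γ := by
  unfold nablaSqConfig nablaSq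
  refine continuous_const.mul (continuous_finsetSum _ fun k _ => continuous_finsetSum _ fun a _ => ?_)
  exact Complex.continuous_normSq.comp ((continuous_apply a).comp
    (continuous_nablaB_fields par Nlow (momentumBox S Sγ) ρ₁ lam S (gcoeffZ Sγ γ) k))

/-- For fixed `γ`, the integrand of (II.37) is continuous in `(A_s, B_l)`. [cite: MagnenRivasseauSeneor1993, (II.37) p.339] -/
theorem continuous_kIntegrand_fields (S Sγ : Finset Momentum) (ρ₁ : ℕ) (lam : ℝ) (P : GhostConfig → ℝ)
    (γ : GhostConfig) :
    Continuous fun AB : Config × Config => kIntegrand par Nlow S Sγ ρ₁ lam AB.1 AB.2 P γ := by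
  unfold kIntegrand
  exact Real.continuous_exp.comp
    ((continuous_const.mul (continuous_nablaSq_fields par Nlow S Sγ ρ₁ lam γ)).sub continuous_const)

/-- **`K_{ρ₂}(A_s, B_l)` IS (JOINTLY) CONTINUOUS IN THE CUT-OFF FIELDS** — dominated convergence against the probability
measure `dν_{ρ₂}` with the bound `1` of `kIntegrand_le_one` («bounded polynomial interaction», p.340 tl.10–11).
[cite: MagnenRivasseauSeneor1993, (II.37) p.339, p.340 tl.10–11] -/
theorem continuous_Knorm (S Sγ : Finset Momentum) (ρ₁ ρ₂ : ℕ) (lam : ℝ) {P : GhostConfig → ℝ}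
    (hP : ∀ γ, 0 ≤ P γ) (hPm : Measurable P) :
    Continuous fun AB : Config × Config => Knorm par Nlow S Sγ ρ₁ ρ₂ lam AB.1 AB.2 P := by
  unfold Knorm
  refine continuous_of_dominated (bound := fun _ => (1 : ℝ)) ?_ ?_ (integrable_const 1) ?_
  · intro AB
    exact (measurable_kIntegrand par Nlow S Sγ ρ₁ lam AB.1 AB.2 hPm).aestronglyMeasurable
  · intro AB
    refine Filter.Eventually.of_forall fun γ => ?_
    rw [Real.norm_eq_abs, abs_of_pos (kIntegrand_pos par Nlow S Sγ ρ₁ lam AB.1 AB.2 P γ)]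
    exact kIntegrand_le_one par Nlow S Sγ ρ₁ lam AB.1 AB.2 hP γ
  · exact Filter.Eventually.of_forall fun γ => continuous_kIntegrand_fields par Nlow S Sγ ρ₁ lam P γ

/-- Hence `K_{ρ₂}` is (jointly Borel) measurable in the fields. [cite: MagnenRivasseauSeneor1993, (II.37) p.339, (II.39) p.340] -/
theorem measurable_Knorm (S Sγ : Finset Momentum) (ρ₁ ρ₂ : ℕ) (lam : ℝ) {P : GhostConfig → ℝ}
    (hP : ∀ γ, 0 ≤ P γ) (hPm : Measurable P) :
    Measurable fun AB : Config × Config => Knorm par Nlow S Sγ ρ₁ ρ₂ lam AB.1 AB.2 P :=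
  (continuous_Knorm par Nlow S Sγ ρ₁ ρ₂ lam hP hPm).measurable

/-- **The factor `[K_{ρ₂}(A_s, B_l)]⁻¹` of (II.39) is a continuous function of the cut-off fields** (`K_{ρ₂} > 0`
everywhere), bounded below by `1`. [cite: MagnenRivasseauSeneor1993, (II.39) p.340 tl.12–14, p.340 tl.10–11] -/
theorem continuous_Knorm_inv (S Sγ : Finset Momentum) (ρ₁ ρ₂ : ℕ) (lam : ℝ) {P : GhostConfig → ℝ}
    (hP : ∀ γ, 0 ≤ P γ) (hPm : Measurable P) :
    Continuous fun AB : Config × Config => (Knorm par Nlow S Sγ ρ₁ ρ₂ lam AB.1 AB.2 P)⁻¹ :=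
  (continuous_Knorm par Nlow S Sγ ρ₁ ρ₂ lam hP hPm).inv₀ fun AB =>
    (Knorm_pos par Nlow S Sγ ρ₁ ρ₂ lam AB.1 AB.2 hP hPm).ne'

/-- `1 ≤ [K_{ρ₂}]⁻¹` (from `0 < K_{ρ₂} ≤ 1`). [cite: MagnenRivasseauSeneor1993, (II.37) p.339, (II.39) p.340] -/
theorem one_le_Knorm_inv (S Sγ : Finset Momentum) (ρ₁ ρ₂ : ℕ) (lam : ℝ) (A B : Config) {P : GhostConfig → ℝ}
    (hP : ∀ γ, 0 ≤ P γ) (hPm : Measurable P) : 1 ≤ (Knorm par Nlow S Sγ ρ₁ ρ₂ lam A B P)⁻¹ :=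
  one_le_inv_iff₀.mpr ⟨Knorm_pos par Nlow S Sγ ρ₁ ρ₂ lam A B hP hPm, Knorm_le_one par Nlow S Sγ ρ₁ ρ₂ lam A B hP⟩

/-! ## §7 (v1.2) (II.48)/(II.50): `∇_{B′_l}·A′_s` in the primed variables and the factor
`e^{−(ζ/2)(∇_{B′_l}·A′_s)²}` of (II.49)/(II.78) as a function of the pair `(A′_s, B′_l)` -/

/-- **(II.50), `∇_{B′_l}·A′_s = ∂_μ(A′_s)_μ − Σ_j λ[κ_j ∗ (B′_l)_μ, κ^j ∗ (A′_s)_μ]`** in momentum space, for the PRIMED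
cut-off fields given as coefficient functions (`λ = λ_j^t`, p.340 tl.7–8; tree `κ_j`, `κ^j`, 𝐏).
[cite: MagnenRivasseauSeneor1993, (II.50) p.342 tl.29, p.340 tl.7–8] -/
def nablaPrime (T : Finset (Fin 4 → ℤ)) (ρ₁ : ℕ) (A' B' : (Fin 4 → ℤ) → Fin 4 → Fin 3 → ℂ)
    (k : Fin 4 → ℤ) : Fin 3 → ℂ :=
  ∑ μ, (dCoeff (fun k' a => A' k' μ a) μ k -
    ∑ j ∈ indexFinset Nlow ρ₁, ((par.sliceCoupling j : ℝ) : ℂ) •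
      convCross (box2 T) (fun q => ((par.kappaLow Nlow ρ₁ j q : ℝ) : ℂ) • fun a => B' q μ a)
        (fun r => ((par.kappaSlice Nlow j r : ℝ) : ℂ) • fun a => A' r μ a) k)

/-- **(II.48) substituted: `∇_B(A_s, B_l, γ, 2) = ∇_{B′_l}·A′_s` with `A′_s = A_s^{γ,2}`, `B′_l = B_l^{rot γ,2}`** —
(II.38) IS (II.50) in the primed variables, definitionally. [cite: MagnenRivasseauSeneor1993, (II.48) p.342 tl.20, (II.50) p.342 tl.29, (II.38) p.339] -/
theorem nablaB_eq_nablaPrime (T : Finset (Fin 4 → ℤ)) (ρ₁ : ℕ) (lam : ℝ) (A B : (Fin 4 → ℤ) → Fin 4 → Fin 3 → ℂ)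
    (G : (Fin 4 → ℤ) → Fin 3 → ℂ) (k : Fin 4 → ℤ) :
    nablaB par Nlow T ρ₁ lam A B G k =
      nablaPrime par Nlow T ρ₁ (fun k' μ a => gaugeTrunc2Coeff T lam A G μ k' a)
        (fun k' μ a => rotTruncCoeff T lam B G μ k' a) k := rfl

/-- **`(∇_{B′_l}·A′_s)²`** (Parseval with the «factor 1/2», READINGS (P), (Z)) for primed configurations `A′_s, B′_l :
Config` cut off at the window `S`. [cite: MagnenRivasseauSeneor1993, (II.49)–(II.50) p.342] -/
def nablaPrimeSq (S : Finset Momentum) (ρ₁ : ℕ) (A' B' : Config) : ℝ :=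
  (1 / 2) * ∑ k ∈ box4 (S.image Subtype.val), ∑ a,
    normSq (nablaPrime par Nlow (S.image Subtype.val) ρ₁ (coeffZ S A') (coeffZ S B') k a)

/-- `(∇_{B′_l}·A′_s)² ≥ 0`. [cite: MagnenRivasseauSeneor1993, (II.49)–(II.50) p.342] -/
theorem nablaPrimeSq_nonneg (S : Finset Momentum) (ρ₁ : ℕ) (A' B' : Config) :
    0 ≤ nablaPrimeSq par Nlow S ρ₁ A' B' :=
  mul_nonneg (by norm_num) (sum_nonneg fun _ _ => sum_nonneg fun _ _ => normSq_nonneg _)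

/-- **The factor `e^{−(ζ/2)(∇_{B′_l}·A′_s)²}` of (II.49) — and, verbatim, of the bare ansatz (II.78), fourth line —** as
a function of the pair of primed cut-off fields, with the NAMED `ζ`.
[cite: MagnenRivasseauSeneor1993, (II.49) p.342, (II.78) p.347 tl.2–7] -/
def gfFactorPrime (S : Finset Momentum) (ρ₁ : ℕ) (A' B' : Config) : ℝ :=
  Real.exp (-(par.ζ / 2) * nablaPrimeSq par Nlow S ρ₁ A' B')

/-- `0 < e^{−(ζ/2)(∇_{B′_l}·A′_s)²} ≤ 1` (`ζ ≥ 0`, `Parameters.hζ`). [cite: MagnenRivasseauSeneor1993, (II.49) p.342, (II.78) p.347, p.374 tl.2] -/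
theorem gfFactorPrime_pos_le_one (S : Finset Momentum) (ρ₁ : ℕ) (A' B' : Config) :
    0 < gfFactorPrime par Nlow S ρ₁ A' B' ∧ gfFactorPrime par Nlow S ρ₁ A' B' ≤ 1 := by
  refine ⟨Real.exp_pos _, ?_⟩
  unfold gfFactorPrime
  rw [Real.exp_le_one_iff]
  have h1 := par.hζ.1
  have h2 := nablaPrimeSq_nonneg par Nlow S ρ₁ A' B'
  nlinarith

/-- `(A′_s, B′_l) ↦ (∇_{B′_l}·A′_s)~(k)` is continuous (polynomial in finitely many coordinates).
[cite: MagnenRivasseauSeneor1993, (II.50) p.342] -/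
theorem continuous_nablaPrime_fields (T : Finset (Fin 4 → ℤ)) (ρ₁ : ℕ) (S : Finset Momentum) (k : Fin 4 → ℤ) :
    Continuous fun AB : Config × Config => nablaPrime par Nlow T ρ₁ (coeffZ S AB.1) (coeffZ S AB.2) k := by
  unfold nablaPrime
  refine continuous_finsetSum _ fun μ _ => Continuous.sub ?_ ?_
  · refine continuous_pi fun a => ?_
    unfold dCoeff
    exact continuous_const.mul ((continuous_coeffZ S k μ a).comp continuous_fst)
  · refine continuous_finsetSum _ fun j _ => ?_
    have h : Continuous fun AB : Config × Config =>
        convCross (box2 T) (fun q => ((par.kappaLow Nlow ρ₁ j q : ℝ) : ℂ) • fun a => coeffZ S AB.2 q μ a)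
          (fun r => ((par.kappaSlice Nlow j r : ℝ) : ℂ) • fun a => coeffZ S AB.1 r μ a) k :=
      continuous_convCross (box2 T)
        (F := fun (AB : Config × Config) q => ((par.kappaLow Nlow ρ₁ j q : ℝ) : ℂ) • fun a => coeffZ S AB.2 q μ a)
        (G := fun (AB : Config × Config) r => ((par.kappaSlice Nlow j r : ℝ) : ℂ) • fun a => coeffZ S AB.1 r μ a)
        (fun q => (continuous_const_smul _).comp
          ((continuous_pi fun a => continuous_coeffZ S q μ a).comp continuous_snd))
        (fun r => (continuous_const_smul _).comp
          ((continuous_pi fun a => continuous_coeffZ S r μ a).comp continuous_fst)) k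
    exact (continuous_const_smul _).comp h

/-- **The (II.78) factor `e^{−(ζ/2)(∇_{B′_l}·A′_s)²}` is a continuous, hence measurable, function of `(A′_s, B′_l)`.**
[cite: MagnenRivasseauSeneor1993, (II.49) p.342, (II.78) p.347] -/
theorem continuous_gfFactorPrime (S : Finset Momentum) (ρ₁ : ℕ) :
    Continuous fun AB : Config × Config => gfFactorPrime par Nlow S ρ₁ AB.1 AB.2 := by
  unfold gfFactorPrime nablaPrimeSq
  refine Real.continuous_exp.comp (continuous_const.mul (continuous_const.mul
    (continuous_finsetSum _ fun k _ => continuous_finsetSum _ fun a _ => ?_)))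
  exact Complex.continuous_normSq.comp ((continuous_apply a).comp
    (continuous_nablaPrime_fields par Nlow (S.image Subtype.val) ρ₁ S k))

/-- … and, for each fixed background `B′_l`, it is INTEGRABLE against the reference Gaussian measure `dμ_{0,ρ₁}(A′)` of
(II.78) (the tree's `muZeroPrime`): a bounded continuous density on a probability space.
[cite: MagnenRivasseauSeneor1993, (II.78) p.347 tl.2–7, (II.44) p.341] -/
theorem integrable_gfFactorPrime_muZeroPrime (S : Finset Momentum) (ρ₁ : ℕ) (B' : Config) :
    Integrable (fun A' => gfFactorPrime par Nlow S ρ₁ A' B') (muZeroPrime par ρ₁) := by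
  have hf : Continuous fun A' : Config => (A', B') := continuous_id.prodMk continuous_const
  have hc := (continuous_gfFactorPrime par Nlow S ρ₁).comp hf
  refine Integrable.of_bound (C := 1) hc.measurable.aestronglyMeasurable (Filter.Eventually.of_forall fun A' => ?_)
  have h := gfFactorPrime_pos_le_one par Nlow S ρ₁ A' B'
  rw [Real.norm_eq_abs, abs_of_pos h.1]
  exact h.2

/-! ## §8 (v1.3) (II.68) p.344: the operator `U(A′_s, B′_l) ≡ ∂² − λ∂[A′_s, ·] − λΣ_j[κ_j ∗ B′_l, κ^j ∗ ∂·]`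
— «the main quadratic piece (ζ/2)(γ′ − γ, UᵗU(γ′ − γ))» — as a LINEAR map on ghost coefficient functions -/

/-- The Laplacian `∂² = ∂_μ∂_μ` on ghost coefficient functions: `Σ_μ (ik_μ)(ik_μ)η̃(k)` (READING (P): `∂_μ ↔ ik_μ`).
[cite: MagnenRivasseauSeneor1993, (II.68) p.344 tl.19, §II.A p.328 tl.12–15] -/
def laplaceCoeff (η : (Fin 4 → ℤ) → Fin 3 → ℂ) (k : Fin 4 → ℤ) : Fin 3 → ℂ :=
  ∑ μ, dCoeff (dCoeff η μ) μ k

/-- `(∂²η)~(k) = −|k|² η̃(k)`. [cite: MagnenRivasseauSeneor1993, (II.68) p.344, §II.A p.328 tl.12–15] -/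
theorem laplaceCoeff_apply (η : (Fin 4 → ℤ) → Fin 3 → ℂ) (k : Fin 4 → ℤ) (a : Fin 3) :
    laplaceCoeff η k a = -(∑ μ, ((k μ : ℤ) : ℂ) ^ 2) * η k a := by
  unfold laplaceCoeff dCoeff
  simp only [Finset.sum_apply]
  rw [neg_mul, Finset.sum_mul, ← Finset.sum_neg_distrib]
  refine Finset.sum_congr rfl fun μ _ => ?_
  linear_combination (((k μ : ℤ) : ℂ) ^ 2 * η k a) * Complex.I_mul_I

/-- **(II.68), `U(A′_s, B′_l)η = ∂²η − λ∂_μ[A′_{s,μ}, η] − Σ_j λ_j^t[κ_j ∗ B′_{l,μ}, κ^j ∗ ∂_μη]`** in momentum space, for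
primed cut-off fields given as coefficient functions and a ghost-type field `η` (in print `η = γ′ − γ`); implicit
`μ`-sums («There are some implicit summations over μ in the formulas above», p.344 tl.11–12); couplings as in (II.38)
(READING (R″): free `λ` in the `A′_s` term, `λ_j^t` inside `Σ_j`, p.340 tl.7–8); tree `κ_j`, `κ^j`, 𝐏.
[cite: MagnenRivasseauSeneor1993, (II.68) p.344 tl.19, (II.67) tl.18, p.344 tl.27–29] -/
def uOp (T : Finset (Fin 4 → ℤ)) (ρ₁ : ℕ) (lam : ℝ) (A' B' : (Fin 4 → ℤ) → Fin 4 → Fin 3 → ℂ)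
    (η : (Fin 4 → ℤ) → Fin 3 → ℂ) (k : Fin 4 → ℤ) : Fin 3 → ℂ :=
  laplaceCoeff η k -
    (lam : ℂ) • ∑ μ, dCoeff (fun k' => convCross (insert 0 T) (fun q => A' q μ) η k') μ k -
    ∑ j ∈ indexFinset Nlow ρ₁, ((par.sliceCoupling j : ℝ) : ℂ) • ∑ μ,
      convCross (box2 T) (fun q => ((par.kappaLow Nlow ρ₁ j q : ℝ) : ℂ) • fun a => B' q μ a)
        (fun r => ((par.kappaSlice Nlow j r : ℝ) : ℂ) • dCoeff η μ r) k

/-- The `B′_l`-term of (II.68) for one index `j` and one direction `μ` (a named sub-expression, for bookkeeping).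
[cite: MagnenRivasseauSeneor1993, (II.68) p.344 tl.19] -/
def uOpB (T : Finset (Fin 4 → ℤ)) (ρ₁ : ℕ) (B' : (Fin 4 → ℤ) → Fin 4 → Fin 3 → ℂ) (η : (Fin 4 → ℤ) → Fin 3 → ℂ)
    (j : ℕ × ℕ) (μ : Fin 4) (k : Fin 4 → ℤ) : Fin 3 → ℂ :=
  convCross (box2 T) (fun q => ((par.kappaLow Nlow ρ₁ j q : ℝ) : ℂ) • fun a => B' q μ a)
    (fun r => ((par.kappaSlice Nlow j r : ℝ) : ℂ) • dCoeff η μ r) k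

/-- (II.68) with the `B′_l`-term named. [cite: MagnenRivasseauSeneor1993, (II.68) p.344 tl.19] -/
theorem uOp_eq (T : Finset (Fin 4 → ℤ)) (ρ₁ : ℕ) (lam : ℝ) (A' B' : (Fin 4 → ℤ) → Fin 4 → Fin 3 → ℂ)
    (η : (Fin 4 → ℤ) → Fin 3 → ℂ) (k : Fin 4 → ℤ) :
    uOp par Nlow T ρ₁ lam A' B' η k = laplaceCoeff η k -
      (lam : ℂ) • ∑ μ, dCoeff (fun k' => convCross (insert 0 T) (fun q => A' q μ) η k') μ k -
      ∑ j ∈ indexFinset Nlow ρ₁, ((par.sliceCoupling j : ℝ) : ℂ) • ∑ μ, uOpB par Nlow T ρ₁ B' η j μ k := rfl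

/-- A wedge-product convolution with a vanishing left factor vanishes. [cite: MagnenRivasseauSeneor1993, §II.A p.328 tl.32–33] -/
theorem convCross_zero_left (U : Finset (Fin 4 → ℤ)) (Y : (Fin 4 → ℤ) → Fin 3 → ℂ) (k : Fin 4 → ℤ) :
    convCross U (fun _ => 0) Y k = 0 := by
  unfold convCross
  refine sum_eq_zero fun q _ => sum_eq_zero fun r _ => ?_
  split_ifs
  · ext a
    fin_cases a <;> simp [crossProduct]
  · rfl

/-- The wedge-product convolution is additive in its right factor (bilinearity of the printed bracket).
[cite: MagnenRivasseauSeneor1993, §II.A p.328 tl.32–33] -/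
theorem convCross_add_right (U : Finset (Fin 4 → ℤ)) (X Y₁ Y₂ : (Fin 4 → ℤ) → Fin 3 → ℂ) (k : Fin 4 → ℤ) :
    convCross U X (Y₁ + Y₂) k = convCross U X Y₁ k + convCross U X Y₂ k := by
  unfold convCross
  rw [← Finset.sum_add_distrib]
  refine Finset.sum_congr rfl fun q _ => ?_
  rw [← Finset.sum_add_distrib]
  refine Finset.sum_congr rfl fun r _ => ?_
  split_ifs
  · simp only [Pi.add_apply, map_add]
  · simp

/-- … and homogeneous in its right factor. [cite: MagnenRivasseauSeneor1993, §II.A p.328 tl.32–33] -/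
theorem convCross_smul_right (U : Finset (Fin 4 → ℤ)) (X Y : (Fin 4 → ℤ) → Fin 3 → ℂ) (c : ℂ) (k : Fin 4 → ℤ) :
    convCross U X (c • Y) k = c • convCross U X Y k := by
  unfold convCross
  simp only [Finset.smul_sum]
  refine Finset.sum_congr rfl fun q _ => Finset.sum_congr rfl fun r _ => ?_
  split_ifs
  · simp only [Pi.smul_apply, map_smul]
  · simp

/-- `∂_μ` is additive … [cite: MagnenRivasseauSeneor1993, §II.A p.328 tl.12–15] -/
theorem dCoeff_add (X Y : (Fin 4 → ℤ) → Fin 3 → ℂ) (μ : Fin 4) (k : Fin 4 → ℤ) :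
    dCoeff (X + Y) μ k = dCoeff X μ k + dCoeff Y μ k := by
  ext a; simp [dCoeff]; ring

/-- … and homogeneous. [cite: MagnenRivasseauSeneor1993, §II.A p.328 tl.12–15] -/
theorem dCoeff_smul (X : (Fin 4 → ℤ) → Fin 3 → ℂ) (c : ℂ) (μ : Fin 4) (k : Fin 4 → ℤ) :
    dCoeff (c • X) μ k = c • dCoeff X μ k := by
  ext a; simp [dCoeff]; ring

/-- `∂²` is additive … [cite: MagnenRivasseauSeneor1993, (II.68) p.344] -/
theorem laplaceCoeff_add (η₁ η₂ : (Fin 4 → ℤ) → Fin 3 → ℂ) (k : Fin 4 → ℤ) :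
    laplaceCoeff (η₁ + η₂) k = laplaceCoeff η₁ k + laplaceCoeff η₂ k := by
  unfold laplaceCoeff
  rw [← Finset.sum_add_distrib]
  refine Finset.sum_congr rfl fun μ _ => ?_
  rw [show dCoeff (η₁ + η₂) μ = dCoeff η₁ μ + dCoeff η₂ μ from funext fun k' => dCoeff_add η₁ η₂ μ k']
  exact dCoeff_add _ _ μ k

/-- … and homogeneous. [cite: MagnenRivasseauSeneor1993, (II.68) p.344] -/
theorem laplaceCoeff_smul (c : ℂ) (η : (Fin 4 → ℤ) → Fin 3 → ℂ) (k : Fin 4 → ℤ) :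
    laplaceCoeff (c • η) k = c • laplaceCoeff η k := by
  unfold laplaceCoeff
  rw [Finset.smul_sum]
  refine Finset.sum_congr rfl fun μ _ => ?_
  rw [show dCoeff (c • η) μ = c • dCoeff η μ from funext fun k' => dCoeff_smul η c μ k']
  exact dCoeff_smul _ c μ k

/-- The `B′_l`-term is additive in `η` … [cite: MagnenRivasseauSeneor1993, (II.68) p.344] -/
theorem uOpB_add (T : Finset (Fin 4 → ℤ)) (ρ₁ : ℕ) (B' : (Fin 4 → ℤ) → Fin 4 → Fin 3 → ℂ)
    (η₁ η₂ : (Fin 4 → ℤ) → Fin 3 → ℂ) (j : ℕ × ℕ) (μ : Fin 4) (k : Fin 4 → ℤ) :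
    uOpB par Nlow T ρ₁ B' (η₁ + η₂) j μ k = uOpB par Nlow T ρ₁ B' η₁ j μ k + uOpB par Nlow T ρ₁ B' η₂ j μ k := by
  unfold uOpB
  rw [← convCross_add_right]
  congr 1
  funext r
  simp only [Pi.add_apply]
  rw [dCoeff_add, smul_add]

/-- … and homogeneous in `η`. [cite: MagnenRivasseauSeneor1993, (II.68) p.344] -/
theorem uOpB_smul (T : Finset (Fin 4 → ℤ)) (ρ₁ : ℕ) (B' : (Fin 4 → ℤ) → Fin 4 → Fin 3 → ℂ) (c : ℂ)
    (η : (Fin 4 → ℤ) → Fin 3 → ℂ) (j : ℕ × ℕ) (μ : Fin 4) (k : Fin 4 → ℤ) :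
    uOpB par Nlow T ρ₁ B' (c • η) j μ k = c • uOpB par Nlow T ρ₁ B' η j μ k := by
  unfold uOpB
  rw [← convCross_smul_right]
  congr 1
  funext r
  simp only [Pi.smul_apply]
  rw [dCoeff_smul, smul_comm]

/-- The `A′_s`-term is additive in `η` … [cite: MagnenRivasseauSeneor1993, (II.68) p.344] -/
theorem uOpA_add (T : Finset (Fin 4 → ℤ)) (A' : (Fin 4 → ℤ) → Fin 4 → Fin 3 → ℂ)
    (η₁ η₂ : (Fin 4 → ℤ) → Fin 3 → ℂ) (μ : Fin 4) (k : Fin 4 → ℤ) :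
    dCoeff (fun k' => convCross (insert 0 T) (fun q => A' q μ) (η₁ + η₂) k') μ k =
      dCoeff (fun k' => convCross (insert 0 T) (fun q => A' q μ) η₁ k') μ k +
        dCoeff (fun k' => convCross (insert 0 T) (fun q => A' q μ) η₂ k') μ k := by
  rw [← dCoeff_add]
  congr 1
  funext k'
  simp only [Pi.add_apply]
  exact convCross_add_right (insert 0 T) _ η₁ η₂ k'

/-- … and homogeneous in `η`. [cite: MagnenRivasseauSeneor1993, (II.68) p.344] -/
theorem uOpA_smul (T : Finset (Fin 4 → ℤ)) (A' : (Fin 4 → ℤ) → Fin 4 → Fin 3 → ℂ) (c : ℂ)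
    (η : (Fin 4 → ℤ) → Fin 3 → ℂ) (μ : Fin 4) (k : Fin 4 → ℤ) :
    dCoeff (fun k' => convCross (insert 0 T) (fun q => A' q μ) (c • η) k') μ k =
      c • dCoeff (fun k' => convCross (insert 0 T) (fun q => A' q μ) η k') μ k := by
  rw [← dCoeff_smul]
  congr 1
  funext k'
  simp only [Pi.smul_apply]
  exact convCross_smul_right (insert 0 T) _ η c k'

/-- **With no fields, `U(0, 0) = ∂²`** — the free ghost Laplacian. [cite: MagnenRivasseauSeneor1993, (II.68) p.344] -/
theorem uOp_zero_fields (T : Finset (Fin 4 → ℤ)) (ρ₁ : ℕ) (lam : ℝ) (η : (Fin 4 → ℤ) → Fin 3 → ℂ)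
    (k : Fin 4 → ℤ) : uOp par Nlow T ρ₁ lam 0 0 η k = laplaceCoeff η k := by
  rw [uOp_eq]
  have h1 : ∀ μ : Fin 4, (fun k' => convCross (insert 0 T) (fun q => (0 : (Fin 4 → ℤ) → Fin 4 → Fin 3 → ℂ) q μ) η k')
      = fun _ => 0 := fun μ => funext fun k' => convCross_zero_left (insert 0 T) η k'
  have h2 : ∀ (j : ℕ × ℕ) (μ : Fin 4), uOpB par Nlow T ρ₁ 0 η j μ k = 0 := by
    intro j μ
    unfold uOpB
    have : (fun q => ((par.kappaLow Nlow ρ₁ j q : ℝ) : ℂ) • fun a => (0 : (Fin 4 → ℤ) → Fin 4 → Fin 3 → ℂ) q μ a)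
        = fun _ => 0 := funext fun q => by ext a; simp
    rw [this]
    exact convCross_zero_left (box2 T) _ k
  have h3 : ∀ μ : Fin 4, dCoeff (fun _ => (0 : Fin 3 → ℂ)) μ k = 0 := fun μ => by ext a; simp [dCoeff]
  simp only [h1, h2, h3, Finset.sum_const_zero, smul_zero, sub_zero]

/-- **`U(A′_s, B′_l)` is ADDITIVE in the ghost field** (a linear operator, as the quadratic form `(γ′ − γ, UᵗU(γ′ − γ))`
of p.344 tl.29 presupposes). [cite: MagnenRivasseauSeneor1993, (II.68) p.344 tl.19, tl.27–29] -/
theorem uOp_add (T : Finset (Fin 4 → ℤ)) (ρ₁ : ℕ) (lam : ℝ) (A' B' : (Fin 4 → ℤ) → Fin 4 → Fin 3 → ℂ)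
    (η₁ η₂ : (Fin 4 → ℤ) → Fin 3 → ℂ) (k : Fin 4 → ℤ) :
    uOp par Nlow T ρ₁ lam A' B' (η₁ + η₂) k = uOp par Nlow T ρ₁ lam A' B' η₁ k + uOp par Nlow T ρ₁ lam A' B' η₂ k := by
  simp only [uOp_eq, laplaceCoeff_add, uOpA_add, uOpB_add, Finset.sum_add_distrib, smul_add]
  module

/-- … and HOMOGENEOUS in the ghost field. [cite: MagnenRivasseauSeneor1993, (II.68) p.344 tl.19, tl.27–29] -/
theorem uOp_smul (T : Finset (Fin 4 → ℤ)) (ρ₁ : ℕ) (lam : ℝ) (A' B' : (Fin 4 → ℤ) → Fin 4 → Fin 3 → ℂ)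
    (c : ℂ) (η : (Fin 4 → ℤ) → Fin 3 → ℂ) (k : Fin 4 → ℤ) :
    uOp par Nlow T ρ₁ lam A' B' (c • η) k = c • uOp par Nlow T ρ₁ lam A' B' η k := by
  simp only [uOp_eq, laplaceCoeff_smul, uOpA_smul, uOpB_smul, ← Finset.smul_sum]
  rw [show (∑ j ∈ indexFinset Nlow ρ₁, ((par.sliceCoupling j : ℝ) : ℂ) • c • ∑ μ, uOpB par Nlow T ρ₁ B' η j μ k) =
      c • ∑ j ∈ indexFinset Nlow ρ₁, ((par.sliceCoupling j : ℝ) : ℂ) • ∑ μ, uOpB par Nlow T ρ₁ B' η j μ k by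
    rw [Finset.smul_sum]
    exact Finset.sum_congr rfl fun j _ => smul_comm _ _ _]
  module

/-! ## §9 (v1.4) (II.62), (II.67)–(II.69) p.343–344: `∇_{RB,γ′−γ}`, `D(A′_s)`, `V(A′_s, B′_l, γ′ − γ)` and the
identity `∇_{RB,γ′−γ} · D(A′_s) = U(A′_s, B′_l) + V(A′_s, B′_l, γ′ − γ)` PROVED EXACTLY AS PRINTED -/

/-- The wedge-product convolution is additive in its LEFT factor. [cite: MagnenRivasseauSeneor1993, §II.A p.328 tl.32–33] -/
theorem convCross_add_left (U : Finset (Fin 4 → ℤ)) (X₁ X₂ Y : (Fin 4 → ℤ) → Fin 3 → ℂ) (k : Fin 4 → ℤ) :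
    convCross U (X₁ + X₂) Y k = convCross U X₁ Y k + convCross U X₂ Y k := by
  unfold convCross
  rw [← Finset.sum_add_distrib]
  refine Finset.sum_congr rfl fun q _ => ?_
  rw [← Finset.sum_add_distrib]
  refine Finset.sum_congr rfl fun r _ => ?_
  split_ifs
  · simp only [Pi.add_apply, LinearMap.map_add₂]
  · simp

/-- … and homogeneous in its LEFT factor. [cite: MagnenRivasseauSeneor1993, §II.A p.328 tl.32–33] -/
theorem convCross_smul_left (U : Finset (Fin 4 → ℤ)) (X Y : (Fin 4 → ℤ) → Fin 3 → ℂ) (c : ℂ) (k : Fin 4 → ℤ) :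
    convCross U (c • X) Y k = c • convCross U X Y k := by
  unfold convCross
  simp only [Finset.smul_sum]
  refine Finset.sum_congr rfl fun q _ => Finset.sum_congr rfl fun r _ => ?_
  split_ifs
  · simp only [Pi.smul_apply, LinearMap.map_smul₂]
  · simp

/-- Subtraction in the left factor. [cite: MagnenRivasseauSeneor1993, §II.A p.328 tl.32–33] -/
theorem convCross_sub_smul_left (U : Finset (Fin 4 → ℤ)) (X₁ X₂ Y : (Fin 4 → ℤ) → Fin 3 → ℂ) (c : ℂ)
    (k : Fin 4 → ℤ) : convCross U (X₁ - c • X₂) Y k = convCross U X₁ Y k - c • convCross U X₂ Y k := by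
  rw [sub_eq_add_neg, ← neg_smul, convCross_add_left, convCross_smul_left, neg_smul, ← sub_eq_add_neg]

/-- Subtraction in the right factor. [cite: MagnenRivasseauSeneor1993, §II.A p.328 tl.32–33] -/
theorem convCross_sub_smul_right (U : Finset (Fin 4 → ℤ)) (X Y₁ Y₂ : (Fin 4 → ℤ) → Fin 3 → ℂ) (c : ℂ)
    (k : Fin 4 → ℤ) : convCross U X (Y₁ - c • Y₂) k = convCross U X Y₁ k - c • convCross U X Y₂ k := by
  rw [sub_eq_add_neg, ← neg_smul, convCross_add_right, convCross_smul_right, neg_smul, ← sub_eq_add_neg]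

/-- **`D(A′_s)η`, the covariant derivative (II.5) «D = ∂ − λ[A, ·]» acting on a ghost-type field**, in momentum space:
`(D_μη)~(k) = ik_μη̃(k) − λ Σ_{q+r=k} Ã′_μ(q) ×₃ η̃(r)`. [cite: MagnenRivasseauSeneor1993, (II.5) p.329 tl.10–11, (II.67) p.344 tl.18] -/
def covDCoeff (T : Finset (Fin 4 → ℤ)) (lam : ℝ) (A' : (Fin 4 → ℤ) → Fin 4 → Fin 3 → ℂ) (η : (Fin 4 → ℤ) → Fin 3 → ℂ)
    (μ : Fin 4) (k : Fin 4 → ℤ) : Fin 3 → ℂ :=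
  dCoeff η μ k - (lam : ℂ) • convCross (insert 0 T) (fun q => A' q μ) η k

/-- **(II.62), the operator `∇_{RB,γ′−γ}`** acting on a vector-type field `X`:
`(∇_{RB,γ′−γ})_μ X = ∂_μ X − Σ_j λ[κ_j ∗ (B′_l)^{rot(γ′−γ),2}_μ, κ^j ∗ X]`, contracted over `μ` («This operator has of
course a spatial index μ which is omitted», p.342 tl.33–34; implicit μ-sums p.344 tl.11–12); `G` = the coefficients
of `γ′ − γ`; `λ = λ_j^t` inside `Σ_j` (READING (R″)). [cite: MagnenRivasseauSeneor1993, (II.62) p.343 tl.32–33, (II.32c) p.339] -/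
def nablaRB (T : Finset (Fin 4 → ℤ)) (ρ₁ : ℕ) (lam : ℝ) (B' : (Fin 4 → ℤ) → Fin 4 → Fin 3 → ℂ)
    (G : (Fin 4 → ℤ) → Fin 3 → ℂ) (X : (Fin 4 → ℤ) → Fin 4 → Fin 3 → ℂ) (k : Fin 4 → ℤ) : Fin 3 → ℂ :=
  ∑ μ, (dCoeff (fun k' => X k' μ) μ k -
    ∑ j ∈ indexFinset Nlow ρ₁, ((par.sliceCoupling j : ℝ) : ℂ) •
      convCross (box2 T) (fun q => ((par.kappaLow Nlow ρ₁ j q : ℝ) : ℂ) • rotTruncCoeff T lam B' G μ q)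
        (fun r => ((par.kappaSlice Nlow j r : ℝ) : ℂ) • X r μ) k)

/-- Consistency with (II.50): at `γ′ − γ = 0` (so `(B′_l)^{rot 0,2} = B′_l`), `∇_{RB,0} X = ∇_{B′_l}·X`.
[cite: MagnenRivasseauSeneor1993, (II.62) p.343, (II.50) p.342] -/
theorem nablaRB_zero_ghost (T : Finset (Fin 4 → ℤ)) (ρ₁ : ℕ) (lam : ℝ) (B' : (Fin 4 → ℤ) → Fin 4 → Fin 3 → ℂ)
    (X : (Fin 4 → ℤ) → Fin 4 → Fin 3 → ℂ) (k : Fin 4 → ℤ) :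
    nablaRB par Nlow T ρ₁ lam B' (fun _ => 0) X k = nablaPrime par Nlow T ρ₁ X B' k := by
  unfold nablaRB nablaPrime rotTruncCoeff
  have h0 : ∀ μ q, convCross (insert 0 T) (fun q' => B' q' μ) (fun _ => (0 : Fin 3 → ℂ)) q = 0 := by
    intro μ q
    unfold convCross
    refine sum_eq_zero fun q' _ => sum_eq_zero fun r _ => ?_
    split_ifs
    · ext a
      fin_cases a <;> simp [crossProduct]
    · rfl
  simp only [h0, smul_zero, sub_zero]

/-- `∇_{RB,γ′−γ}` with the slice sum outermost (the implicit `μ`-sum commuted inside).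
[cite: MagnenRivasseauSeneor1993, (II.62) p.343, p.344 tl.11–12] -/
theorem nablaRB_eq' (T : Finset (Fin 4 → ℤ)) (ρ₁ : ℕ) (lam : ℝ) (B' : (Fin 4 → ℤ) → Fin 4 → Fin 3 → ℂ)
    (G : (Fin 4 → ℤ) → Fin 3 → ℂ) (X : (Fin 4 → ℤ) → Fin 4 → Fin 3 → ℂ) (k : Fin 4 → ℤ) :
    nablaRB par Nlow T ρ₁ lam B' G X k = ∑ μ, dCoeff (fun k' => X k' μ) μ k -
      ∑ j ∈ indexFinset Nlow ρ₁, ((par.sliceCoupling j : ℝ) : ℂ) • ∑ μ,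
        convCross (box2 T) (fun q => ((par.kappaLow Nlow ρ₁ j q : ℝ) : ℂ) • rotTruncCoeff T lam B' G μ q)
          (fun r => ((par.kappaSlice Nlow j r : ℝ) : ℂ) • X r μ) k := by
  unfold nablaRB
  rw [Finset.sum_sub_distrib, Finset.sum_comm]
  simp only [Finset.smul_sum]

/-- **(II.69), `V(A′_s, B′_l, γ′ − γ) = + λ²Σ_j[κ_j ∗ [B′_l, γ′ − γ], κ^j ∗ ∂·] + λ²Σ_j[κ_j ∗ (B′_l)^{rot γ′−γ}, κ^j ∗ [A′_s, ·]]`**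
acting on a ghost-type field `η`, in momentum space (each printed `λ²` = `λ_j^t · λ` under READING (R″): one slice
coupling from the `Σ_j` of (II.62), one gauge coupling from `B^{rot}` resp. `D`; the print's «]A′_s, ·]» read as
`[A′_s, ·]`). [cite: MagnenRivasseauSeneor1993, (II.69) p.344 tl.20–22] -/
def vOp (T : Finset (Fin 4 → ℤ)) (ρ₁ : ℕ) (lam : ℝ) (A' B' : (Fin 4 → ℤ) → Fin 4 → Fin 3 → ℂ)
    (G η : (Fin 4 → ℤ) → Fin 3 → ℂ) (k : Fin 4 → ℤ) : Fin 3 → ℂ :=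
  (lam : ℂ) • ∑ j ∈ indexFinset Nlow ρ₁, ((par.sliceCoupling j : ℝ) : ℂ) • ∑ μ,
      convCross (box2 T)
        (fun q => ((par.kappaLow Nlow ρ₁ j q : ℝ) : ℂ) • convCross (insert 0 T) (fun q' => B' q' μ) G q)
        (fun r => ((par.kappaSlice Nlow j r : ℝ) : ℂ) • dCoeff η μ r) k +
  (lam : ℂ) • ∑ j ∈ indexFinset Nlow ρ₁, ((par.sliceCoupling j : ℝ) : ℂ) • ∑ μ,
      convCross (box2 T)
        (fun q => ((par.kappaLow Nlow ρ₁ j q : ℝ) : ℂ) • rotTruncCoeff T lam B' G μ q)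
        (fun r => ((par.kappaSlice Nlow j r : ℝ) : ℂ) • convCross (insert 0 T) (fun q' => A' q' μ) η r) k

/-- `V` carries an overall factor `λ`: it vanishes at zero gauge coupling («Since V is small (with a factor λ²)»,
p.344 tl.27). [cite: MagnenRivasseauSeneor1993, (II.69) p.344 tl.20–27] -/
theorem vOp_zero_coupling (T : Finset (Fin 4 → ℤ)) (ρ₁ : ℕ) (A' B' : (Fin 4 → ℤ) → Fin 4 → Fin 3 → ℂ)
    (G η : (Fin 4 → ℤ) → Fin 3 → ℂ) (k : Fin 4 → ℤ) : vOp par Nlow T ρ₁ 0 A' B' G η k = 0 := by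
  simp [vOp]

/-- The `∂`-part of `∇_{RB}·D(A′_s)η`: `Σ_μ ∂_μ(D_μη) = ∂²η − λ Σ_μ ∂_μ[A′_{s,μ}, η]`.
[cite: MagnenRivasseauSeneor1993, (II.67)–(II.68) p.344] -/
theorem sum_dCoeff_covDCoeff (T : Finset (Fin 4 → ℤ)) (lam : ℝ) (A' : (Fin 4 → ℤ) → Fin 4 → Fin 3 → ℂ)
    (η : (Fin 4 → ℤ) → Fin 3 → ℂ) (k : Fin 4 → ℤ) :
    ∑ μ, dCoeff (fun k' => covDCoeff T lam A' η μ k') μ k =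
      laplaceCoeff η k - (lam : ℂ) • ∑ μ, dCoeff (fun k' => convCross (insert 0 T) (fun q => A' q μ) η k') μ k := by
  unfold laplaceCoeff
  rw [Finset.smul_sum, ← Finset.sum_sub_distrib]
  refine Finset.sum_congr rfl fun μ _ => ?_
  have h : (fun k' => covDCoeff T lam A' η μ k') =
      dCoeff η μ - (lam : ℂ) • fun k' => convCross (insert 0 T) (fun q => A' q μ) η k' := by
    funext k'; simp [covDCoeff]
  rw [h, sub_eq_add_neg, ← neg_smul, dCoeff_add, dCoeff_smul, neg_smul, ← sub_eq_add_neg]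

/-- The interaction part, one index `j`, one direction `μ`: expanding `(B′_l)^{rot(γ′−γ),2} = B′_l − λ[B′_l, γ′−γ]` on
the left and `D_μη = ∂_μη − λ[A′_μ, η]` on the right of the wedge-product convolution (bilinearity).
[cite: MagnenRivasseauSeneor1993, (II.62) p.343, (II.67)–(II.69) p.344] -/
theorem convCross_rot_covD (T : Finset (Fin 4 → ℤ)) (ρ₁ : ℕ) (lam : ℝ) (A' B' : (Fin 4 → ℤ) → Fin 4 → Fin 3 → ℂ)
    (G η : (Fin 4 → ℤ) → Fin 3 → ℂ) (j : ℕ × ℕ) (μ : Fin 4) (k : Fin 4 → ℤ) :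
    convCross (box2 T) (fun q => ((par.kappaLow Nlow ρ₁ j q : ℝ) : ℂ) • rotTruncCoeff T lam B' G μ q)
        (fun r => ((par.kappaSlice Nlow j r : ℝ) : ℂ) • covDCoeff T lam A' η μ r) k =
      uOpB par Nlow T ρ₁ B' η j μ k -
        (lam : ℂ) • convCross (box2 T)
          (fun q => ((par.kappaLow Nlow ρ₁ j q : ℝ) : ℂ) • convCross (insert 0 T) (fun q' => B' q' μ) G q)
          (fun r => ((par.kappaSlice Nlow j r : ℝ) : ℂ) • dCoeff η μ r) k -
        (lam : ℂ) • convCross (box2 T)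
          (fun q => ((par.kappaLow Nlow ρ₁ j q : ℝ) : ℂ) • rotTruncCoeff T lam B' G μ q)
          (fun r => ((par.kappaSlice Nlow j r : ℝ) : ℂ) • convCross (insert 0 T) (fun q' => A' q' μ) η r) k := by
  -- right factor: κ^j • (∂η − λ A′∗×η) = (κ^j • ∂η) − λ • (κ^j • A′∗×η)
  have hR : (fun r => ((par.kappaSlice Nlow j r : ℝ) : ℂ) • covDCoeff T lam A' η μ r) =
      (fun r => ((par.kappaSlice Nlow j r : ℝ) : ℂ) • dCoeff η μ r) -
        (lam : ℂ) • fun r => ((par.kappaSlice Nlow j r : ℝ) : ℂ) • convCross (insert 0 T) (fun q' => A' q' μ) η r := by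
    funext r
    simp only [covDCoeff, Pi.sub_apply, Pi.smul_apply, smul_sub]
    rw [smul_comm]
  -- left factor: κ_j • (B′ − λ B′∗×G) = (κ_j • B′) − λ • (κ_j • B′∗×G)
  have hL : (fun q => ((par.kappaLow Nlow ρ₁ j q : ℝ) : ℂ) • rotTruncCoeff T lam B' G μ q) =
      (fun q => ((par.kappaLow Nlow ρ₁ j q : ℝ) : ℂ) • fun a => B' q μ a) -
        (lam : ℂ) • fun q => ((par.kappaLow Nlow ρ₁ j q : ℝ) : ℂ) • convCross (insert 0 T) (fun q' => B' q' μ) G q := by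
    funext q
    simp only [rotTruncCoeff, Pi.sub_apply, Pi.smul_apply, smul_sub]
    rw [smul_comm]
  rw [hR, convCross_sub_smul_right]
  congr 1
  rw [hL, convCross_sub_smul_left]
  rfl

/-- **(II.67) PROVED EXACTLY AS PRINTED: `∇_{RB,γ′−γ} · D(A′_s) = U(A′_s, B′_l) + V(A′_s, B′_l, γ′ − γ)`** as operators
on the ghost-type field (momentum space; every window `T`, all `ρ₁`, `λ`, all primed fields `A′_s, B′_l`, every
`γ′ − γ`), with `U` = (II.68) (`uOp`) and `V` = (II.69) (`vOp`). [cite: MagnenRivasseauSeneor1993, (II.67)–(II.69) p.344 tl.17–22, (II.62) p.343] -/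
theorem nablaRB_covD_eq_uOp_add_vOp (T : Finset (Fin 4 → ℤ)) (ρ₁ : ℕ) (lam : ℝ)
    (A' B' : (Fin 4 → ℤ) → Fin 4 → Fin 3 → ℂ) (G η : (Fin 4 → ℤ) → Fin 3 → ℂ) (k : Fin 4 → ℤ) :
    nablaRB par Nlow T ρ₁ lam B' G (fun k' μ => covDCoeff T lam A' η μ k') k =
      uOp par Nlow T ρ₁ lam A' B' η k + vOp par Nlow T ρ₁ lam A' B' G η k := by
  rw [nablaRB_eq', uOp_eq, sum_dCoeff_covDCoeff]
  unfold vOp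
  simp only [convCross_rot_covD, smul_sub, Finset.sum_sub_distrib, Finset.smul_sum, smul_smul,
    mul_comm (lam : ℂ)]
  module

/-! ## §10 (v1.5) (II.61)/(II.63) p.343–344: substituting (II.56)–(II.60) into (II.55) — the regrouping
`∇_B(X + S, B^{rot} + S′) = ∇_{RB}·X + S″` PROVED with the CORRECTED `S″`; the printed (II.63) double-counts the cross
term `Σ_j λ[κ_j ∗ S′, κ^j ∗ S]` (finding (l), exhibited) -/

/-- `∇_{RB,γ′−γ}` IS the (II.50)/(II.38) operator with the background replaced by `(B′_l)^{rot(γ′−γ),2}` — definitionally.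
[cite: MagnenRivasseauSeneor1993, (II.62) p.343, (II.50) p.342] -/
theorem nablaRB_eq_nablaPrime_rot (T : Finset (Fin 4 → ℤ)) (ρ₁ : ℕ) (lam : ℝ) (B' : (Fin 4 → ℤ) → Fin 4 → Fin 3 → ℂ)
    (G : (Fin 4 → ℤ) → Fin 3 → ℂ) (X : (Fin 4 → ℤ) → Fin 4 → Fin 3 → ℂ) (k : Fin 4 → ℤ) :
    nablaRB par Nlow T ρ₁ lam B' G X k = nablaPrime par Nlow T ρ₁ X (fun k' μ a => rotTruncCoeff T lam B' G μ k' a) k :=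
  rfl

/-- **`S″` — the CORRECTED reading of (II.63)**: `S″ = ∂S − Σ_j λ[κ_j ∗ S′, κ^j ∗ (X + S)] − Σ_j λ[κ_j ∗ B^{rot}, κ^j ∗ S]`
for generic coefficient functions `X` (= `A′_s + D(A′_s)(γ′ − γ)`), `S` (= `S(A′_s, γ, γ′)`), `Brot` (= `(B′_l)^{rot(γ′−γ),2}`),
`S′`; the print's second sum carries `(B′_l)^{rot(γ′−γ)} + S′` instead of `(B′_l)^{rot(γ′−γ)}` (see `remS2Printed`).
[cite: MagnenRivasseauSeneor1993, (II.63) p.344 tl.2–4, (II.61) p.343 tl.26–31] -/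
def remS2 (T : Finset (Fin 4 → ℤ)) (ρ₁ : ℕ) (X S Brot S' : (Fin 4 → ℤ) → Fin 4 → Fin 3 → ℂ) (k : Fin 4 → ℤ) :
    Fin 3 → ℂ :=
  ∑ μ, (dCoeff (fun k' a => S k' μ a) μ k -
    ∑ j ∈ indexFinset Nlow ρ₁, ((par.sliceCoupling j : ℝ) : ℂ) •
      (convCross (box2 T) (fun q => ((par.kappaLow Nlow ρ₁ j q : ℝ) : ℂ) • fun a => S' q μ a)
          (fun r => ((par.kappaSlice Nlow j r : ℝ) : ℂ) • fun a => (X + S) r μ a) k +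
        convCross (box2 T) (fun q => ((par.kappaLow Nlow ρ₁ j q : ℝ) : ℂ) • fun a => Brot q μ a)
          (fun r => ((par.kappaSlice Nlow j r : ℝ) : ℂ) • fun a => S r μ a) k))

/-- **`S″` AS PRINTED in (II.63)**: `S″ = ∂S − Σ_j λ[κ_j ∗ S′, κ^j ∗ (A′_s + D(A′_s)(γ′ − γ) + S(A′_s,γ,γ′))] − Σ_j λ[κ_j ∗
((B′_l)^{rot(γ′−γ)} + S′), κ^j ∗ S(A′_s,γ,γ′)]` (2× crop `renders/p20_crop_r650-1150_s2.png` in the seat folder).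
[cite: MagnenRivasseauSeneor1993, (II.63) p.344 tl.2–4] -/
def remS2Printed (T : Finset (Fin 4 → ℤ)) (ρ₁ : ℕ) (X S Brot S' : (Fin 4 → ℤ) → Fin 4 → Fin 3 → ℂ) (k : Fin 4 → ℤ) :
    Fin 3 → ℂ :=
  ∑ μ, (dCoeff (fun k' a => S k' μ a) μ k -
    ∑ j ∈ indexFinset Nlow ρ₁, ((par.sliceCoupling j : ℝ) : ℂ) •
      (convCross (box2 T) (fun q => ((par.kappaLow Nlow ρ₁ j q : ℝ) : ℂ) • fun a => S' q μ a)
          (fun r => ((par.kappaSlice Nlow j r : ℝ) : ℂ) • fun a => (X + S) r μ a) k +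
        convCross (box2 T) (fun q => ((par.kappaLow Nlow ρ₁ j q : ℝ) : ℂ) • fun a => (Brot + S') q μ a)
          (fun r => ((par.kappaSlice Nlow j r : ℝ) : ℂ) • fun a => S r μ a) k))

/-- The double-counted cross term `Σ_μ Σ_j λ_j^t [κ_j ∗ S′_μ, κ^j ∗ S_μ]`. [cite: MagnenRivasseauSeneor1993, (II.63) p.344] -/
def remS2Cross (T : Finset (Fin 4 → ℤ)) (ρ₁ : ℕ) (S S' : (Fin 4 → ℤ) → Fin 4 → Fin 3 → ℂ) (k : Fin 4 → ℤ) :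
    Fin 3 → ℂ :=
  ∑ μ, ∑ j ∈ indexFinset Nlow ρ₁, ((par.sliceCoupling j : ℝ) : ℂ) •
    convCross (box2 T) (fun q => ((par.kappaLow Nlow ρ₁ j q : ℝ) : ℂ) • fun a => S' q μ a)
      (fun r => ((par.kappaSlice Nlow j r : ℝ) : ℂ) • fun a => S r μ a) k

/-- Plumbing: a momentum multiplier times a sum of coefficient functions splits (private helper). [folklore] -/
private theorem smul_fun_add (c : (Fin 4 → ℤ) → ℂ) (F G : (Fin 4 → ℤ) → Fin 4 → Fin 3 → ℂ) (μ : Fin 4) :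
    (fun q => c q • fun a => (F + G) q μ a) = (fun q => c q • fun a => F q μ a) + fun q => c q • fun a => G q μ a := by
  funext q; ext a; simp [mul_add]

/-- Plumbing: the `μ`-component of a sum of coefficient functions is the sum of the components (private helper). [folklore] -/
private theorem fun_add (F G : (Fin 4 → ℤ) → Fin 4 → Fin 3 → ℂ) (μ : Fin 4) :
    (fun k' a => (F + G) k' μ a) = (fun k' a => F k' μ a) + fun k' a => G k' μ a := by
  funext k'; ext a; simp

/-- **(II.61) PROVED with the corrected `S″`:** for all coefficient functions, `∇(X + S, Brot + S′) = ∇(X, Brot) + S″`,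
where `∇(A, B) = ∂_μA_μ − Σ_j λ[κ_j ∗ B_μ, κ^j ∗ A_μ]` is the common shape of (II.38)/(II.50)/(II.62) (`nablaPrime`;
`nablaB_eq_nablaPrime`, `nablaRB_eq_nablaPrime_rot`). With `X = A′_s + D(A′_s)(γ′ − γ)`, `S`, `Brot = (B′_l)^{rot(γ′−γ),2}`,
`S′` from (II.56)–(II.60) (PROVED pointwise in `…InfinitesimalGauge` §8) this is the printed regrouping (II.61).
[cite: MagnenRivasseauSeneor1993, (II.61) p.343 tl.26–31, (II.63) p.344] -/
theorem nablaPrime_reexpand (T : Finset (Fin 4 → ℤ)) (ρ₁ : ℕ) (X S Brot S' : (Fin 4 → ℤ) → Fin 4 → Fin 3 → ℂ)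
    (k : Fin 4 → ℤ) :
    nablaPrime par Nlow T ρ₁ (X + S) (Brot + S') k =
      nablaPrime par Nlow T ρ₁ X Brot k + remS2 par Nlow T ρ₁ X S Brot S' k := by
  unfold nablaPrime remS2
  rw [← Finset.sum_add_distrib]
  refine Finset.sum_congr rfl fun μ _ => ?_
  simp only [fun_add X S μ, dCoeff_add, smul_fun_add, convCross_add_left, convCross_add_right, smul_add,
    Finset.sum_add_distrib]
  abel

/-- **FINDING (l), exhibited: the printed `S″` of (II.63) exceeds the corrected one by exactly the cross term counted
twice:** `S″_printed = S″ − Σ_μ Σ_j λ_j^t[κ_j ∗ S′_μ, κ^j ∗ S_μ]`. [cite: MagnenRivasseauSeneor1993, (II.63) p.344 tl.2–4] -/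
theorem remS2Printed_eq (T : Finset (Fin 4 → ℤ)) (ρ₁ : ℕ) (X S Brot S' : (Fin 4 → ℤ) → Fin 4 → Fin 3 → ℂ)
    (k : Fin 4 → ℤ) :
    remS2Printed par Nlow T ρ₁ X S Brot S' k =
      remS2 par Nlow T ρ₁ X S Brot S' k - remS2Cross par Nlow T ρ₁ S S' k := by
  unfold remS2Printed remS2 remS2Cross
  rw [← Finset.sum_sub_distrib]
  refine Finset.sum_congr rfl fun μ _ => ?_
  simp only [smul_fun_add, convCross_add_left, convCross_add_right, smul_add, Finset.sum_add_distrib]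
  abel

/-- Hence (II.61) with `S″` AS PRINTED holds iff the double-counted term vanishes (not adjudicated; `S″` only feeds the
«small correction term» `Σ` of (II.64)/(II.65), so the slip is harmless for the argument).
[cite: MagnenRivasseauSeneor1993, (II.61) p.343, (II.63)–(II.65) p.344] -/
theorem nablaPrime_reexpand_printed_iff (T : Finset (Fin 4 → ℤ)) (ρ₁ : ℕ)
    (X S Brot S' : (Fin 4 → ℤ) → Fin 4 → Fin 3 → ℂ) (k : Fin 4 → ℤ) :
    nablaPrime par Nlow T ρ₁ (X + S) (Brot + S') k =
        nablaPrime par Nlow T ρ₁ X Brot k + remS2Printed par Nlow T ρ₁ X S Brot S' k ↔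
      remS2Cross par Nlow T ρ₁ S S' k = 0 := by
  rw [nablaPrime_reexpand, remS2Printed_eq, add_right_inj, eq_sub_iff_add_eq, add_eq_left]

/-! ## §11 (v1.6) (II.64)/(II.65) p.344: completing the square — `(∇_{RB}·X + S″)² = (∇_{RB}·X)² + Σ(A′, γ, γ′)`,
`Σ = 2S″·(∇_{RB}·X) + (S″)²` — EXACT in the Parseval reading (P) -/

/-- The «square» of a colour-vector coefficient family on a momentum box, `½ Σ_{k∈box} Σ_a |F̃^a(k)|²` (READING (P), the
«factor 1/2» convention of §II.A), as used for `(∇_B)²` (`nablaSq`), `(∇_{B′_l}·A′_s)²` (`nablaPrimeSq`).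
[cite: MagnenRivasseauSeneor1993, §II.A p.328 tl.12–15, (II.64) p.344] -/
def sqNormBox (box : Finset (Fin 4 → ℤ)) (F : (Fin 4 → ℤ) → Fin 3 → ℂ) : ℝ :=
  (1 / 2) * ∑ k ∈ box, ∑ a, normSq (F k a)

/-- The matching real scalar product `F·G = ½ Σ_{k∈box} Σ_a Re(F̃^a(k) conj(G̃^a(k)))` («we write them like squares instead of
scalar products», p.344 tl.25). [cite: MagnenRivasseauSeneor1993, (II.65) p.344 tl.9, p.344 tl.25–26] -/
def dotBox (box : Finset (Fin 4 → ℤ)) (F G : (Fin 4 → ℤ) → Fin 3 → ℂ) : ℝ :=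
  (1 / 2) * ∑ k ∈ box, ∑ a, (F k a * conj (G k a)).re

/-- **(II.65), `Σ(A′, γ, γ′) = 2S″·(∇_{RB,γ′−γ}·(A′_s + D(A′_s)(γ′ − γ))) + (S″)²`** for the coefficient families `N`
(= `∇_{RB,γ′−γ}·(A′_s + D(A′_s)(γ′−γ))`) and `S2` (= `S″`) — «a small correction term which will be treated as an
interaction». [cite: MagnenRivasseauSeneor1993, (II.65) p.344 tl.9–11] -/
def sigmaCorr (box : Finset (Fin 4 → ℤ)) (N S2 : (Fin 4 → ℤ) → Fin 3 → ℂ) : ℝ :=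
  2 * dotBox box S2 N + sqNormBox box S2

/-- **(II.64) PROVED EXACTLY: `(∇_{RB}·X + S″)² = (∇_{RB}·X)² + Σ`** with `Σ` of (II.65), on every momentum box.
[cite: MagnenRivasseauSeneor1993, (II.64)–(II.65) p.344 tl.6–11] -/
theorem sqNormBox_add (box : Finset (Fin 4 → ℤ)) (N S2 : (Fin 4 → ℤ) → Fin 3 → ℂ) :
    sqNormBox box (N + S2) = sqNormBox box N + sigmaCorr box N S2 := by
  unfold sigmaCorr dotBox sqNormBox
  have h : ∀ k a, normSq ((N + S2) k a) = normSq (N k a) + (2 * (S2 k a * conj (N k a)).re + normSq (S2 k a)) := by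
    intro k a
    simp only [Pi.add_apply, Complex.normSq_add]
    have : (N k a * conj (S2 k a)).re = (S2 k a * conj (N k a)).re := by
      rw [← Complex.conj_re (N k a * conj (S2 k a)), map_mul, Complex.conj_conj, mul_comm]
    rw [this]
    ring
  simp only [h, Finset.sum_add_distrib, ← Finset.mul_sum]
  ring

/-- `Σ` vanishes when `S″ = 0` (no correction without re-expansion error). [cite: MagnenRivasseauSeneor1993, (II.65) p.344] -/
theorem sigmaCorr_zero (box : Finset (Fin 4 → ℤ)) (N : (Fin 4 → ℤ) → Fin 3 → ℂ) : sigmaCorr box N 0 = 0 := by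
  simp [sigmaCorr, dotBox, sqNormBox]

/-- The squares used so far ARE `sqNormBox`: `(∇_{B′_l}·A′_s)²` of §7. [cite: MagnenRivasseauSeneor1993, (II.49)–(II.50) p.342] -/
theorem nablaPrimeSq_eq_sqNormBox (S : Finset Momentum) (ρ₁ : ℕ) (A' B' : Config) :
    nablaPrimeSq par Nlow S ρ₁ A' B' =
      sqNormBox (box4 (S.image Subtype.val))
        (fun k => nablaPrime par Nlow (S.image Subtype.val) ρ₁ (coeffZ S A') (coeffZ S B') k) := rfl

end MainStatement

end Literature.MathematicalPhysics.QuantumFieldTheory.MagnenRivasseauSeneor1993
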